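import Mathlib.Combinatorics.Nullstellensatz
import Mathlib.LinearAlgebra.FiniteDimensional.Lemmas
import Mathlib.LinearAlgebra.Matrix.ToLinearEquiv
import Mathlib.LinearAlgebra.Matrix.NonsingularInverse
import Literature.Barriers.ValiantsHypothesis.CKRST20NaturalProofsExist
import Literature.Computability.AlgebraicComplexity.ArithCircuitProofs
import Literature.Computability.AlgebraicComplexity.ConstantFreeValiant
import Literature.Computability.AlgebraicComplexity.HamiltonianCycleVNP0
import Literature.Computability.AlgebraicComplexity.IMMInVPProofs
import Literature.Computability.AlgebraicComplexity.LinSubstProofs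
import Literature.Computability.AlgebraicComplexity.PermanentVNP0
import Literature.Computability.AlgebraicComplexity.SparseCircuitBounds
import HarnessLib

/-!
# Chatterjee–Tengse, *Lower bounds from succinct hitting sets* (arXiv:2309.07612v2): the algebraic
# core — circuits with projection gates (`VPSPACE`), annihilators of explicit polynomial maps,
# interpolating sets and evaluation vectors (val-lit t18 g7, cross-ladder row X-CT23; desk lead-np,
# RULING (88)(b))

Source. P. Chatterjee, A. Tengse, *Lower Bounds from Succinct Hitting Sets*, arXiv:2309.07612
(v1, 14 Sep 2023, also ECCC; **v2, 13 May 2025 — the numbering used here**); bib key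
`ChatterjeeTengse2023`. NUMBERING: every theorem-like environment of the source shares one
counter per section, so v2 reads Def. 1.1, Thm. 1.2, …, Lemma 4.7; the cell's held text
`paper:arxiv-2309.07612` (24 chunks `pNNNN.txt`) is v1 with SEQUENTIAL numbers (Def. 27 = v2
Def. 2.19, Lemma 39 = v2 Lemma 3.2, Thm. 43 = v2 Thm. 3.6, Prop. 47 = v2 Prop. 4.4, Prop. 49 =
v2 Prop. 4.6, Lemma 50 = v2 Lemma 4.7). Docstrings give the v2 number and the v1 chunk locator
`pNNNN:Lnn`.

Honest framing (val-lit). STATEMENTS of a published paper plus definitions with bodies and a few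
proved lemmas; the two cite-tagged `def … : Prop` (`CT23_thm_3_1`, `CT23_lemma_4_7`) are NAMED
FACTS (D-0014), published theorems the tree does not prove. `VP ≠ VNP` is NOT proved and nothing here is progress on it: the
theorems of this source are CONSEQUENCES OF the natural-proofs barrier hypothesis (FSV Question 6,
the tree's `SuccinctHittingSetsForVP`, crux `stmt-ValiantsHypothesis-14610` of route BarrierLever)
— "the existence of VP-succinct hitting sets for VP … would either imply … VP ≠ VNP, or yield a
fairly strong lower bound against TC⁰ circuits, assuming the Generalized Riemann Hypothesis"
(abstract) — and of the weaker `VPSPACE` upper bound on equations for `VP` that this file types.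

## The model typed here (§2.2 of the source)

* **Projection gates** (Def. 2.19, Poizat 2008): a gate `proj_{w = b}`, `b ∈ {0, 1}`, returns its
  input polynomial with the variable `w` set to `b`: `proj_{w=b} f(w, x) = f(b, x)` — the tree's
  `projVar`. A **circuit with projection gates** (`ProjCircuit`) is the tree's straight-line
  `ArithCircuit` (weighted-sum and product gates over operands `var i` / `const c` / `gate j`,
  `Literature/Computability/AlgebraicComplexity/ArithCircuit.lean`) with one more gate kind
  `proj i b u`; size = number of gates, fan-in two and "sign constants" (`{0, 1, -1}` — the
  source's constant-free circuits, Def. 2.2) exactly as for `ArithCircuit`. (The source measures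
  size by wires; for fan-in-two gates the two measures differ by a factor `≤ 3`, absorbed in the
  unspecified exponents `c` of the typed facts — said per decl.) `ofArithCircuit` embeds ordinary
  circuits (`eval_ofArithCircuit`).
* **`VPSPACE⁰`** (Def. 2.20 [Poizat 2008]): integer families computed by constant-free projection
  circuits of size `poly(N)` over the variables of `P_N` plus `poly(N)` bound WORKSPACE variables
  (the variables the source's gates bind; the circuit computes `rename Sum.inl P_N`) —
  `IsVPSPACE0Family`; **`VPSPACE⁰_b`**: the same with p-bounded
  degree — `IsVPSPACE0bFamily`; **`VPSPACE`** over `F ∈ {ℚ, ℝ, ℂ}` (Def. 2.22: "obtained from a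
  `VPSPACE⁰` family `Q_M`, `M = poly(N)`, by setting some variables to constants from `F`") —
  `IsVPSPACEFamily`, and `VPSPACE_b` (the bounded-degree part, §2.2 "Comparison with VP") —
  `IsVPSPACEbFamily`. The source's other, Boolean definition of `VPSPACE⁰` (Def. 2.18 [KP09]:
  coefficient functions computable in `PSPACE`) and the equivalence Prop. 2.21 [P08b, M11] are
  NOT typed (see "not typed" below).
* **Explicit polynomial maps** (Def. 1.7): a polynomial `C(z, y)` ENCODES the map
  `G = (g_1(z), …, g_n(z))` if each `g_i` is `C(z, a_i)` for some assignment `a_i` of constants to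
  `y` — `Encodes`.
* **Interpolating set and evaluation vectors** (Def. 4.3, Prop. 4.4 [BP20, Thm. 10], Def. 4.5):
  `simplexPoints n d = {a ∈ ℕ^n : Σ a_i ≤ d}`, indexed in this file by the monomials `x^{≤ d}`
  (`monomialsDegLE n d`, the tree's coefficient index set) via `m ↦ (m_1, …, m_n)`
  (`exponentPoint`, `mem_simplexPoints_iff`), and `evalVector F d f = (f(m_1, …, m_n))_{|m| ≤ d}`;
  Prop. 4.4 is PROVED (`eq_zero_of_forall_eval_exponentPoint_eq_zero`: a polynomial of total
  degree `≤ d` vanishing on `I_{n,d}` is zero — by Alon's Combinatorial Nullstellensatz on the box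
  below a top-degree monomial, which lies inside the simplex; hence the evaluation map is injective
  on degree-`≤ d` polynomials, `evalVector_injOn`; the Vandermonde matrix of `I_{n,d}` is
  invertible, `isUnit_det_simplexVandermonde`, and its inverse is the printed "linear
  transformation `M`", `CT23_prop_4_4`).

## What is typed, and how (decl ↦ printed item)

* Lemma 3.2, existence half ("`det(M̃)` is an annihilator of `G` that has individual degree at
  most `D − 1`", with `D^n > (ndD)^m`) ↦ PROVED by the printed dimension count
  (`exists_annihilator_degreeOf_lt`: columns = monomials of individual degree `< D`, rows =
  monomials of degree `≤ n(D−1)d`); the corollaries used by Thm. 3.1 (`n ≥ 2m` ⇒ individual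
  degree `≤ nd`, `exists_annihilator_degreeOf_le_of_two_mul_le`; and the printed `≤ 3md` by
  restricting to the first `2m` outputs, `exists_annihilator_degreeOf_le_three_mul`). The explicit-matrix half of Lemma 3.2
  (rank extractor `E_α`, Claim 3.3 = the Gabizon–Raz / [FS12] condenser — the tree's
  `Literature.Computability.AlgebraicComplexity.ASSS16.rank_mul_powMatrix_eq_rank` and
  `FS12RankCondenser.lean`) is internal machinery of the source's proof and is not restated.
* Thm. 3.1 [Annihilators of explicit maps] ↦ FACT `CT23_thm_3_1` (R1; the `VPSPACE`
  succinct-determinant construction §2.4/§3.2 is not attempted); encoder and annihilator circuits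
  carry bound workspace variables (`⊕ Fin w`, `⊕ Fin t`).
* Lemma 4.7 (multilinear equations for the EVALUATION VECTORS of size-`s` degree-`d` `n`-variate
  polynomials by constant-free projection circuits of size `(nds)^c`) ↦ FACT `CT23_lemma_4_7` (R1),
  WITH the regime hypothesis `(nds)^c ≤ binom(n+d, d)` its proof uses; the printed quantifiers
  alone ("for all large enough `n, d, s`") are REFUTED in the kernel (`not_CT23_lemma_4_7_asPrinted`:
  for `s` large against `binom(n+d,d)` every degree-`≤ d` polynomial is in the class and the
  evaluation map is onto, so no nonzero equation exists).

ERRATUM (same seat, recorded for the review lanes). The first accepted text of this file (p515197,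
2026-08-27) typed `IsVPSPACE0Family`, `CT23_thm_3_1` and `CT23_lemma_4_7` with WORKSPACE-FREE
projection circuits (variables = those of the computed polynomial only) — stronger than the
source, whose gates bind auxiliary variables — and `CT23_lemma_4_7` with the printed quantifiers
only (false as printed, see above). Both were corrected in place within the hour; no declaration
or ledger item depended on the first text.
* Prop. 4.6 (equations for evaluation vectors versus natural proofs) ↦ PROVED in the `VP`-size
  currency of the tree for the direction the source uses (an equation for coefficient vectors of
  complexity `t` gives one for evaluation vectors of complexity `t + poly(N)` and conversely):
  `exists_evalEquation_of_coeffEquation` / `exists_coeffEquation_of_evalEquation`, both via the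
  linear change of coordinates between coefficient and evaluation vectors (Prop. 4.4).
* Def. 2.19 / Def. 2.23 as circuit surgery (Appendix at the end of the file): one projection gate
  (`ProjCircuit.projectionCircuit`, `+1` gate) and the source's simulation of summation /
  production gates by two projections and a sum / product (`ProjCircuit.summationCircuit`,
  `ProjCircuit.productionCircuit`, `+3` gates), with `eval_*`, `size_*`, `isFanInTwo_*`,
  `hasSignConstants_*`; attainment of `projComplexity` / `constantFreeProjComplexity` (over `ℤ`),
  the cost bounds `projComplexity_projVar_le` / `_summation_le` / `_production_le` and their
  constant-free twins, `constantFreeProjComplexity_le_constantFreeComplexity`; at family level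
  **`VP⁰ ⊆ VPSPACE⁰`** (`isVPSPACE0Family_of_isVP0Family`, §2.2 "Comparison with VP") and the
  closure of `VPSPACE⁰` under projections / summations / productions
  (`IsVPSPACE0Family.projVar/summation/production`) — all PROVED, no facts.
* **`VNP⁰ ⊆ VPSPACE⁰`** (`isVPSPACE0Family_of_isVNP0Family`, last section): Valiant's Boolean sum
  over `u(N)` bits is `u(N)` summation gates over WORKSPACE bits on top of the `VP⁰` circuit
  (`ProjCircuit.boolSumCircuit`, `partialBoolSum`, `summation_partialBoolSum`,
  `partialBoolSum_eq_rename_boolSum`) — PROVED; the adequacy test for the workspace variables;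
  corollaries `isVPSPACE0Family_perPoly` (**`PER ∈ VPSPACE⁰`**) and `isVPSPACE0Family_hcPoly`.
* Lemma 4.7 AS PRINTED is kept as a typed decl `CT23_lemma_4_7_asPrinted` (refuted:
  `not_CT23_lemma_4_7_asPrinted`), next to the repaired `CT23_lemma_4_7` — the erratum shape of
  the cell's registry (A40/B40).

## What is NOT typed, and why

* Thm. 1.2 [Hardness from Succinct Hitting Sets], Thm. 1.9 [Lower Bounds from Cryptographic
  HSGs] (second bullet), Thm. 4.1 (second clause), Prop. 2.26, Prop. 2.27, Prop. 4.8, and the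
  uniform-space clause of Thm. 1.4 [Equations for VP]: they quantify over the Generalized Riemann
  Hypothesis and `DLOGTIME`-uniform `TC⁰` / `NC¹`, which the tree's Boolean-complexity vocabulary
  (`Literature/Computability/Complexity/`) does not have; recorded here in prose only
  (v1 chunks p0004:L57–p0005:L10, p0005:L70–90, p0017:L25–30, p0018:L40–60).
* Def. 2.18 / Prop. 2.21 (`VPSPACE⁰` via coefficient functions computable in `PSPACE` [KP09]
  equals the projection-gate class [P08b, M11]; "we believe that this statement is not entirely obvious", §5): a Boolean
  statement with advice; not needed by the typed items.
* The FAMILY-LEVEL corollaries Thm. 1.11 / Thm. 3.6 (annihilator families in `VPSPACE_b` for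
  `VP_d`- resp. `VPSPACE_b`-explicit families of maps `G_m` with `> 2m` outputs) and Thm. 4.1,
  first clause ("If the family `{H_m}` is a hitting set generator for `VP_d`, then
  `VP ≠ VPSPACE_b`"): their content over Thm. 3.1 is bookkeeping, but the source's family
  conventions — "`f_n` depends on at most `n^c` variables" (Def. 2.5) with an unbounded number of
  ambient variables, and the re-indexing `m ↦ n(m)` of an `m`-indexed annihilator family as a
  member of the `n`-indexed class `VP_d` in the proof of Thm. 4.1 — do not transcribe into the
  tree's `IsVPFamily` / `IsVPSPACE0Family` (p-bounded variable TYPES) without choices the source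
  does not make; no BarrierLever item consumes them today (RULING (88)(b): docstring, not a fact).
  Recorded for the route's barrier section (BC8): by Thm. 4.1 with Prop. 2.25 [KP09, Prop. 3]
  ("If `VP ≠ VPSPACE_b`, then either `VP ≠ VNP` or `P/poly ≠ PSPACE/poly`"), a `VP`-succinct
  generator for `VP` — which crux `stmt-ValiantsHypothesis-14610` `SuccinctHittingSetsForVP` yields
  through the universal circuit — would separate `VP` from `VPSPACE_b`, hence prove
  `VP ≠ VNP ∨ P/poly ≠ PSPACE/poly` (v1 chunks p0011:L44–46, p0017:L25–28).
* Def. 1.1 / 1.8 / 2.12–2.15 (succinct and cryptographic hitting-set generators, natural proofs):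
  these are the tree's `IsSuccinctHittingSet`, `IsHittingSetGenerator`, `IsSuccinctGenerator`,
  `IsNaturalProof`, `SmallCircuits`, `Distinguishers`, `SuccinctHittingSetsForVP`
  (`AlgebraicNaturalProofs.lean`, `AlgebraicNaturalProofsGenerators.lean`) — CITED, not restated.
* Lemma 2.11 (universal circuits [Raz 2010]) is the tree's
  `Literature.Computability.AlgebraicComplexity.RazUniversal.exists_universalCircuit`
  (`UniversalCircuit.lean`; integer form `exists_universalCircuit_int`) — cited.
* §2.3–2.4 (explicit matrices / ABPs, the succinct determinant Prop. 2.30) and §5: proof machinery.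

## Consumers (RULING (88)(b): one sentence per fact)

* `CT23_lemma_4_7` conditions a rung below crux `stmt-ValiantsHypothesis-8749`
  `SingleSizeEquations` / `stmt-ValiantsHypothesis-8745` `DefinableEquations` of route BarrierLever:
  for every FIXED size exponent `b`, equations for `VP_n(n^b)` (degree `n`, size `n^b`) exist that
  are computable by constant-free PROJECTION circuits of size `poly(n)` ("`VPSPACE⁰_b`-natural"),
  where 8749 asks for Boolean sums of `poly(N)`-size circuits ("`VNP_N`-natural"); the source's
  Remark 1.5: "A `VP(N)` upper bound on the equations of `VP(n)` would rule out a barrier … The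
  bound we show is incomparable to `VNP(N)`."
* `CT23_thm_3_1` conditions the same items for ANY explicitly encoded map (in particular the
  coefficient or evaluation map of the tree's universal circuit `RazUniversal.exists_universalCircuit`,
  the generator behind `FSV2018_lemma13`), with explicit size `(m·d·s)^c` and individual degree
  `≤ 3md`.
* (Docstring only, see "not typed":) Thm. 4.1 + Prop. 2.25 bear on crux
  `stmt-ValiantsHypothesis-14610` `SuccinctHittingSetsForVP` itself — proving the crux would prove
  `VP ≠ VNP ∨ P/poly ≠ PSPACE/poly` ("barrier on the barrier").

## Field

The source works over `ℚ`, `ℝ` or `ℂ` (Def. 2.22; Def. 1.7 over `ℂ`) and writes `𝔽` in §3; its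
rank extractor (Lemma 2.8 [FS12]) needs `nr` distinct powers `α^{ij}`. The facts are typed for
fields of characteristic `0` (`[CharZero F]`), which is what the proofs use; the proved lemmas
hold over any field (Lemma 3.2's count) resp. any integral domain (Prop. 4.4).

## References

* [ChatterjeeTengse2023] P. Chatterjee, A. Tengse, *Lower Bounds from Succinct Hitting Sets*,
  arXiv:2309.07612v2 (2025), §1.1, §2.2, §3, §4.
* B. Poizat, *À la recherche de la définition de la complexité d'espace pour le calcul des
  polynômes à la manière de Valiant*, J. Symb. Logic 73 (2008) (projection gates; cited via the
  source's Def. 2.19–2.20); G. Malod, *Succinct algebraic branching programs …*, 2011; P. Koiran,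
  S. Perifel, *VPSPACE and a transfer theorem over the reals*, Comput. Complexity 18 (2009).
* M. Bläser, A. Pandey, *Polynomial identity testing for low degree polynomials with optimal
  randomness*, APPROX/RANDOM 2020, Thm. 10 (the interpolating set `I_{n,d}`; the source's
  Prop. 4.4).
* N. Alon, *Combinatorial Nullstellensatz* (1999), Thm. 2 — Mathlib
  `MvPolynomial.combinatorial_nullstellensatz_exists_eval_nonzero` (used for Prop. 4.4).
-/

noncomputable section

open MvPolynomial
open scoped BigOperators

namespace Literature.Barriers.ValiantsHypothesis

open Literature.Computability.AlgebraicComplexity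

universe u v w

/-! ### §2.2: projection gates and circuits with projections (Def. 2.19, 2.20, 2.22, 2.23) -/

section Projection

variable {k : Type u} [CommSemiring k] {σ : Type v} [DecidableEq σ]

/-- **Projection of one variable** (the semantics of the source's projection gate, Def. 2.19:
"`proj_{w = b} f(w, x) = f(b, x)`"): substitute the constant `b` for the variable `i` and leave
every other variable alone. [cite: ChatterjeeTengse2023, Def. 2.19 (v1: Def. 27)]
locator: paper:arxiv-2309.07612 p0010.txt:L70 -/
def projVar (i : σ) (b : k) (f : MvPolynomial σ k) : MvPolynomial σ k :=
  aeval (fun j => if j = i then C b else X j) f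

/-- A projection fixes constants. [cite: ChatterjeeTengse2023, Def. 2.19 (v1: Def. 27)] -/
@[simp] theorem projVar_C (i : σ) (b c : k) : projVar i b (C c : MvPolynomial σ k) = C c := by
  simp [projVar]

/-- `proj_{w = b} w = b`. [cite: ChatterjeeTengse2023, Def. 2.19 (v1: Def. 27)] -/
@[simp] theorem projVar_X_self (i : σ) (b : k) : projVar i b (X i : MvPolynomial σ k) = C b := by
  simp [projVar]

/-- `proj_{w = b} x_j = x_j` for `j ≠ w`. [cite: ChatterjeeTengse2023, Def. 2.19 (v1: Def. 27)] -/
@[simp] theorem projVar_X_of_ne {i j : σ} (h : j ≠ i) (b : k) :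
    projVar i b (X j : MvPolynomial σ k) = X j := by
  simp [projVar, h]

/-- **Summation gate** (Def. 2.23): `Σ_z f := proj_{z=0} f + proj_{z=1} f`.
[cite: ChatterjeeTengse2023, Def. 2.23 (v1: Def. 30)] locator: paper:arxiv-2309.07612 p0011.txt:L7 -/
def summation (i : σ) (f : MvPolynomial σ k) : MvPolynomial σ k :=
  projVar i 0 f + projVar i 1 f

/-- **Production gate** (Def. 2.23): `Π_z f := proj_{z=0} f × proj_{z=1} f`.
[cite: ChatterjeeTengse2023, Def. 2.23 (v1: Def. 30)] locator: paper:arxiv-2309.07612 p0011.txt:L7 -/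
def production (i : σ) (f : MvPolynomial σ k) : MvPolynomial σ k :=
  projVar i 0 f * projVar i 1 f

/-- Projecting a variable commutes with an injective renaming of the variables (used to read a
free-variable polynomial inside a ring with extra workspace variables, `rename Sum.inl`).
[cite: ChatterjeeTengse2023, Def. 2.19 (v1: Def. 27)] -/
theorem projVar_rename {τ : Type w} [DecidableEq τ] {e : σ → τ} (he : Function.Injective e)
    (i : σ) (b : k) (f : MvPolynomial σ k) :
    projVar (e i) b (rename e f) = rename e (projVar i b f) := by
  have h : (aeval fun j : τ => if j = e i then C b else (X j : MvPolynomial τ k)).comp (rename e) =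
      (rename e).comp (aeval fun j : σ => if j = i then C b else (X j : MvPolynomial σ k)) := by
    refine MvPolynomial.algHom_ext fun j => ?_
    by_cases hj : j = i
    · subst hj; simp
    · simp [hj, he.ne hj]
  exact DFunLike.congr_fun h f

/-- Summation over a variable commutes with an injective renaming.
[cite: ChatterjeeTengse2023, Def. 2.23 (v1: Def. 30)] -/
theorem summation_rename {τ : Type w} [DecidableEq τ] {e : σ → τ} (he : Function.Injective e)
    (i : σ) (f : MvPolynomial σ k) :
    summation (e i) (rename e f) = rename e (summation i f) := by
  simp [summation, projVar_rename he, map_add]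

/-- Production over a variable commutes with an injective renaming.
[cite: ChatterjeeTengse2023, Def. 2.23 (v1: Def. 30)] -/
theorem production_rename {τ : Type w} [DecidableEq τ] {e : σ → τ} (he : Function.Injective e)
    (i : σ) (f : MvPolynomial σ k) :
    production (e i) (rename e f) = rename e (production i f) := by
  simp [production, projVar_rename he, map_mul]

end Projection

/-- A gate of a circuit with projections: an ordinary weighted-sum / product gate of the tree's
`ArithCircuit` model, or a **projection gate** `proj i b u` (Def. 2.19) applied to one operand
`u`, labelled by the variable `i` and the Boolean constant `b`.
[cite: ChatterjeeTengse2023, Def. 2.19–2.20 (v1: Def. 27–28)] locator: paper:arxiv-2309.07612 p0010.txt:L70–L78 -/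
inductive ProjCircuit.Gate (k : Type u) (σ : Type v) : Type max u v
  /-- An arithmetic gate (weighted sum or product) of the tree's `ArithCircuit` model. -/
  | arith (g : ArithCircuit.Gate k σ) : ProjCircuit.Gate k σ
  /-- The projection gate `proj_{X i = b}` applied to the operand `u` (`b : Bool` read as `0`/`1`). -/
  | proj (i : σ) (b : Bool) (u : ArithCircuit.Operand k σ) : ProjCircuit.Gate k σ

/-- **A (straight-line) algebraic circuit with projection gates** ("an algebraic circuit … that
additionally has access to projection gates", Def. 2.20): a list of gates in topological order
(gate `i` refers to gates `j < i` through operands `gate j`; out-of-range references evaluate to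
the junk value `0`, as in `ArithCircuit`) and an output operand.
[cite: ChatterjeeTengse2023, Def. 2.20 (v1: Def. 28)] locator: paper:arxiv-2309.07612 p0010.txt:L76 -/
structure ProjCircuit (k : Type u) (σ : Type v) : Type max u v where
  /-- The gates, in topological order. -/
  gates : List (ProjCircuit.Gate k σ)
  /-- The output operand. -/
  output : ArithCircuit.Operand k σ

namespace ProjCircuit

variable {k : Type u} {σ : Type v}

section Semantics

variable [CommSemiring k] [DecidableEq σ]

/-- Semantics of a gate given the values of the earlier gates: arithmetic gates as in
`ArithCircuit.Gate.eval`; `proj i b u ↦ projVar i b (value of u)` with `b ↦ 1`/`0`.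
[cite: ChatterjeeTengse2023, Def. 2.19 (v1: Def. 27)] -/
def Gate.eval (vals : List (MvPolynomial σ k)) : Gate k σ → MvPolynomial σ k
  | .arith g => g.eval vals
  | .proj i b u => projVar i (if b then 1 else 0) (u.eval vals)

/-- The list of gate values, computed by a left fold exactly as `ArithCircuit.gateValues`.
[cite: ChatterjeeTengse2023, Def. 2.20 (v1: Def. 28)] -/
def gateValues (gs : List (Gate k σ)) : List (MvPolynomial σ k) :=
  gs.foldl (fun vals g => vals ++ [g.eval vals]) []

/-- The polynomial computed by a circuit with projections: the value of its output operand.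
[cite: ChatterjeeTengse2023, Def. 2.20 (v1: Def. 28)] -/
def eval (P : ProjCircuit k σ) : MvPolynomial σ k :=
  P.output.eval (gateValues P.gates)

/-- `P.Computes f`: the circuit `P` computes `f`. [cite: ChatterjeeTengse2023, Def. 2.20 (v1: Def. 28)] -/
def Computes (P : ProjCircuit k σ) (f : MvPolynomial σ k) : Prop :=
  P.eval = f

end Semantics

section Measures

/-- Size = number of gates (the source counts wires, Def. 2.1; for fan-in-two circuits the two
measures differ by a factor at most `3`). [cite: ChatterjeeTengse2023, Def. 2.1 and Def. 2.20 (v1: Def. 9, 28)] -/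
def size (P : ProjCircuit k σ) : ℕ :=
  P.gates.length

/-- Fan-in of a gate (a projection gate has one operand). [cite: ChatterjeeTengse2023, Def. 2.19 (v1: Def. 27)] -/
def Gate.fanIn : Gate k σ → ℕ
  | .arith g => g.fanIn
  | .proj _ _ _ => 1

/-- Every gate has at most two operands. [cite: ChatterjeeTengse2023, Def. 2.1 (v1: Def. 9)] -/
def IsFanInTwo (P : ProjCircuit k σ) : Prop :=
  ∀ g ∈ P.gates, g.fanIn ≤ 2

variable [CommSemiring k]

/-- A gate is constant-free ("sign constants": all constants and sum coefficients in `{0, 1, -1}`,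
the tree's `ArithCircuit.Gate.HasSignConstants`; Def. 2.2 "the only field constants that appear
in it are `1` and `-1`"). [cite: ChatterjeeTengse2023, Def. 2.2 (v1: Def. 10)] -/
def Gate.HasSignConstants : Gate k σ → Prop
  | .arith g => g.HasSignConstants
  | .proj _ _ u => u.HasSignConstants

/-- A circuit with projections is **constant-free** if all its gates and its output operand have
sign constants (Def. 2.2 / Def. 2.20 "constant-free algebraic circuit … with projection gates").
[cite: ChatterjeeTengse2023, Def. 2.2 and Def. 2.20 (v1: Def. 10, 28)] -/
def HasSignConstants (P : ProjCircuit k σ) : Prop :=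
  (∀ g ∈ P.gates, g.HasSignConstants) ∧ P.output.HasSignConstants

end Measures

section Embedding

variable [CommSemiring k] [DecidableEq σ]

/-- An ordinary arithmetic circuit is a circuit with (no) projection gates.
[cite: ChatterjeeTengse2023, Def. 2.20 (v1: Def. 28)] -/
def ofArithCircuit (Q : ArithCircuit k σ) : ProjCircuit k σ where
  gates := Q.gates.map Gate.arith
  output := Q.output

/-- Folding arithmetic gates through the `ProjCircuit` evaluator agrees with `ArithCircuit`. [folklore] -/
private theorem foldl_arith_eq (gs : List (ArithCircuit.Gate k σ)) (init : List (MvPolynomial σ k)) :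
    (gs.map Gate.arith).foldl (fun vals g => vals ++ [g.eval vals]) init =
      gs.foldl (fun vals g => vals ++ [g.eval vals]) init := by
  induction gs generalizing init with
  | nil => rfl
  | cons g gs ih =>
    simp only [List.map_cons, List.foldl_cons]
    exact ih _

/-- The embedded circuit has the same gate values. [cite: ChatterjeeTengse2023, Def. 2.20 (v1: Def. 28)] -/
theorem gateValues_map_arith (gs : List (ArithCircuit.Gate k σ)) :
    gateValues (gs.map Gate.arith) = ArithCircuit.gateValues gs :=
  foldl_arith_eq gs []

/-- The embedding preserves the computed polynomial. [cite: ChatterjeeTengse2023, Def. 2.20 (v1: Def. 28)] -/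
@[simp] theorem eval_ofArithCircuit (Q : ArithCircuit k σ) : (ofArithCircuit Q).eval = Q.eval := by
  simp [eval, ofArithCircuit, gateValues_map_arith, ArithCircuit.eval]

omit [CommSemiring k] [DecidableEq σ] in
/-- The embedding preserves size. [cite: ChatterjeeTengse2023, Def. 2.20 (v1: Def. 28)] -/
@[simp] theorem size_ofArithCircuit (Q : ArithCircuit k σ) : (ofArithCircuit Q).size = Q.size := by
  simp [size, ofArithCircuit, ArithCircuit.size]

omit [CommSemiring k] [DecidableEq σ] in
/-- The embedding preserves fan-in two. [cite: ChatterjeeTengse2023, Def. 2.20 (v1: Def. 28)] -/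
theorem isFanInTwo_ofArithCircuit {Q : ArithCircuit k σ} (h : Q.IsFanInTwo) :
    (ofArithCircuit Q).IsFanInTwo := by
  intro g hg
  simp only [ofArithCircuit, List.mem_map] at hg
  obtain ⟨g', hg', rfl⟩ := hg
  exact h g' hg'

omit [DecidableEq σ] in
/-- The embedding preserves constant-freeness. [cite: ChatterjeeTengse2023, Def. 2.20 (v1: Def. 28)] -/
theorem hasSignConstants_ofArithCircuit {Q : ArithCircuit k σ} (h : Q.HasSignConstants) :
    (ofArithCircuit Q).HasSignConstants := by
  refine ⟨fun g hg => ?_, h.2⟩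
  simp only [ofArithCircuit, List.mem_map] at hg
  obtain ⟨g', hg', rfl⟩ := hg
  exact h.1 g' hg'

end Embedding

end ProjCircuit

/-! ### Projection-circuit complexity and the classes `VPSPACE⁰`, `VPSPACE⁰_b`, `VPSPACE`, `VPSPACE_b` -/

section Classes

variable {k : Type u} [CommSemiring k] {σ : Type v} [DecidableEq σ]

/-- The least size of a fan-in-two circuit WITH PROJECTION GATES computing `f` (arbitrary
constants). At most the tree's `complexity f` (`projComplexity_le_complexity`).
[cite: ChatterjeeTengse2023, Def. 2.20 and Thm. 3.1 (v1: Def. 28, §3)] -/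
def projComplexity (f : MvPolynomial σ k) : ℕ :=
  sInf {s | ∃ P : ProjCircuit k σ, P.IsFanInTwo ∧ P.Computes f ∧ P.size = s}

/-- The least size of a CONSTANT-FREE fan-in-two circuit with projection gates computing `f`
(junk value `0` = `sInf ∅` when no constant-free circuit computes `f`, e.g. `f = C (1/2)`; over `ℤ`
the set is nonempty, `constantFreeProjComplexity_le_constantFreeComplexity`).
[cite: ChatterjeeTengse2023, Def. 2.20 (v1: Def. 28)] -/
def constantFreeProjComplexity (f : MvPolynomial σ k) : ℕ :=
  sInf {s | ∃ P : ProjCircuit k σ, P.IsFanInTwo ∧ P.HasSignConstants ∧ P.Computes f ∧ P.size = s}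

/-- A circuit with projections bounds the projection complexity by its size.
[cite: ChatterjeeTengse2023, Def. 2.20 (v1: Def. 28)] -/
theorem projComplexity_le_size {P : ProjCircuit k σ} {f : MvPolynomial σ k} (h2 : P.IsFanInTwo)
    (hf : P.Computes f) : projComplexity f ≤ P.size :=
  Nat.sInf_le ⟨P, h2, hf, rfl⟩

/-- A constant-free circuit with projections bounds the constant-free projection complexity.
[cite: ChatterjeeTengse2023, Def. 2.20 (v1: Def. 28)] -/
theorem constantFreeProjComplexity_le_size {P : ProjCircuit k σ} {f : MvPolynomial σ k}
    (h2 : P.IsFanInTwo) (hc : P.HasSignConstants) (hf : P.Computes f) :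
    constantFreeProjComplexity f ≤ P.size :=
  Nat.sInf_le ⟨P, h2, hc, hf, rfl⟩

/-- Projection gates only help: `projComplexity f ≤ complexity f` (embed an optimal ordinary
circuit, `ArithCircuit.exists_computes_size_eq_complexity`).
[cite: ChatterjeeTengse2023, §2.2 "Comparison with VP" (v1: p0011.txt:L20)] -/
theorem projComplexity_le_complexity (f : MvPolynomial σ k) : projComplexity f ≤ complexity f := by
  obtain ⟨Q, h2, hf, hs⟩ := ArithCircuit.exists_computes_size_eq_complexity f
  rw [← hs, ← ProjCircuit.size_ofArithCircuit Q]
  exact projComplexity_le_size (ProjCircuit.isFanInTwo_ofArithCircuit h2)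
    (by simpa [ProjCircuit.Computes, ArithCircuit.Computes] using hf)

/-- A constant-free ordinary circuit bounds the constant-free projection complexity.
[cite: ChatterjeeTengse2023, §2.2 (v1: p0011.txt:L20)] -/
theorem constantFreeProjComplexity_le_of_arithCircuit {Q : ArithCircuit k σ} {f : MvPolynomial σ k}
    (h2 : Q.IsFanInTwo) (hc : Q.HasSignConstants) (hf : Q.Computes f) :
    constantFreeProjComplexity f ≤ Q.size := by
  rw [← ProjCircuit.size_ofArithCircuit Q]
  exact constantFreeProjComplexity_le_size (ProjCircuit.isFanInTwo_ofArithCircuit h2)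
    (ProjCircuit.hasSignConstants_ofArithCircuit hc)
    (by simpa [ProjCircuit.Computes, ArithCircuit.Computes] using hf)

end Classes

section Families

variable {σ : ℕ → Type v} [∀ N, Fintype (σ N)] [∀ N, DecidableEq (σ N)]

/-- **`VPSPACE⁰`** (Def. 2.20 [Poizat 2008]: "A family `{P_N}` of integer polynomials is said to
be in `VPSPACE⁰` if for all large `N`, there is a constant-free algebraic circuit, say `C`, that
additionally has access to projection gates such that `C` has size `poly(N)` and `P_N` is the
polynomial computed by `C`"), as a predicate on integer families in the tree's style
(`IsVP0Family`): p-bounded number of variables and, for every `N`, a constant-free fan-in-two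
projection circuit of p-bounded size over the variables of `P_N` AND p-boundedly many auxiliary
**workspace variables** `Fin (t N)` — the variables BOUND by the source's projection / summation /
production gates (Def. 2.23 `Σ_z f(z, x)`: `z` is not a variable of the result; the source's
circuits `C'(x)` name their free variables only) — computing `P_N` read in the bigger ring
(`rename Sum.inl (P N)`: the result does not depend on the workspace). ("For all large `N`" is
absorbed by `IsPBounded`'s additive constant since every integer polynomial has SOME constant-free
circuit.) ERRATUM (same seat): the first accepted text of this file (p515197) omitted the
workspace (`C N : ProjCircuit ℤ (σ N)`), a class possibly SMALLER than the source's (no bound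
variables beyond those of `P_N`); corrected here, no decl depended on it.
[cite: ChatterjeeTengse2023, Def. 2.20 (v1: Def. 28)] locator: paper:arxiv-2309.07612 p0010.txt:L76 -/
def IsVPSPACE0Family (P : ∀ N, MvPolynomial (σ N) ℤ) : Prop :=
  IsPBounded (fun N => Fintype.card (σ N)) ∧
    ∃ (t : ℕ → ℕ) (C : ∀ N, ProjCircuit ℤ (σ N ⊕ Fin (t N))),
      IsPBounded t ∧
        (∀ N, (C N).IsFanInTwo ∧ (C N).HasSignConstants ∧
          (C N).Computes (rename Sum.inl (P N))) ∧
        IsPBounded fun N => (C N).size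

/-- **`VPSPACE⁰_b`**: the bounded-degree part of `VPSPACE⁰` (§2.2 "Comparison with VP": "a
bounded degree analogue of `VPSPACE` written as `VPSPACE_b`", Prop. 2.24: "the polynomial
families of degree `poly(n)` that belong to `VPSPACE`"), constant-free version.
[cite: ChatterjeeTengse2023, §2.2 before Prop. 2.24 (v1: p0011.txt:L22–28)] -/
def IsVPSPACE0bFamily (P : ∀ N, MvPolynomial (σ N) ℤ) : Prop :=
  IsVPSPACE0Family P ∧ IsPBounded fun N => (P N).totalDegree

variable (F : Type u) [Field F]

/-- **`VPSPACE`** over `F` (Def. 2.22: "Let `F` be the field of rationals, reals or complexes. A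
family `{P_N}` of polynomials over `F` is in `VPSPACE`, if there exists an `M = poly(N)` and a
family `{Q_M} ∈ VPSPACE⁰`, such that for all `N`, `P_N` is obtained from `Q_M` by setting some
variables to constants from `F`"). Rendering: an integer family `Q` in `VPSPACE⁰` on variables
`σ N ⊕ Fin (u N)` (so `M = poly(N)` is `#σ N + u N`, p-bounded by `IsVPSPACE0Family`, whose
circuits carry their own bound workspace variables on top) and constants `κ_N : Fin (u N) → F`
with `P_N = Q_N(X, κ_N)` read over `F`.
[cite: ChatterjeeTengse2023, Def. 2.22 (v1: Def. 29)] locator: paper:arxiv-2309.07612 p0011.txt:L1 -/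
def IsVPSPACEFamily (P : ∀ N, MvPolynomial (σ N) F) : Prop :=
  ∃ (u : ℕ → ℕ) (Q : ∀ N, MvPolynomial (σ N ⊕ Fin (u N)) ℤ) (κ : ∀ N, Fin (u N) → F),
    IsVPSPACE0Family Q ∧
      ∀ N, P N = aeval (Sum.elim X fun j => C (κ N j)) (MvPolynomial.map (Int.castRingHom F) (Q N))

/-- **`VPSPACE_b`** over `F`: the families of p-bounded degree in `VPSPACE` (Prop. 2.24's wording).
[cite: ChatterjeeTengse2023, §2.2 before Prop. 2.24 (v1: p0011.txt:L22–28)] -/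
def IsVPSPACEbFamily (P : ∀ N, MvPolynomial (σ N) F) : Prop :=
  IsVPSPACEFamily F P ∧ IsPBounded fun N => (P N).totalDegree

end Families

/-! ### Def. 1.7: circuits encoding polynomial maps -/

section Encodes

variable {k : Type u} [CommSemiring k] {σ : Type v} {τ : Type w} {ι : Type*}

/-- **Def. 1.7 (a polynomial ENCODES a polynomial map).** "We say that a circuit `C(z, y)` encodes
`H` if there are assignments `a_1, a_2, …, a_N` to `y`, such that for each `i ∈ [N]`,
`C(x, a_i) = h_i(x)`." Stated for the polynomial `U(z, y)` computed by the circuit (the circuit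
enters the typed theorems only through a size bound on a `ProjCircuit` computing `U`).
[cite: ChatterjeeTengse2023, Def. 1.7 (v1: Def. 5)] locator: paper:arxiv-2309.07612 p0005.txt:L38 -/
def Encodes (U : MvPolynomial (σ ⊕ τ) k) (G : ι → MvPolynomial σ k) : Prop :=
  ∀ i, ∃ a : τ → k, aeval (Sum.elim X fun j => C (a j)) U = G i

/-- Unfolding of `Encodes`. [cite: ChatterjeeTengse2023, Def. 1.7 (v1: Def. 5)] -/
theorem encodes_iff (U : MvPolynomial (σ ⊕ τ) k) (G : ι → MvPolynomial σ k) :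
    Encodes U G ↔ ∀ i, ∃ a : τ → k, aeval (Sum.elim X fun j => C (a j)) U = G i := Iff.rfl

end Encodes


/-! ### Lemma 3.2 (existence half): annihilators of bounded individual degree by a dimension count -/

section Annihilator

variable {K : Type u} [Field K]

/-- The exponent vector `(e_1, …, e_n) ∈ {0, …, D-1}^n` as a finitely supported function.
[cite: ChatterjeeTengse2023, Lemma 3.2 (v1: Lemma 39)] -/
def boxExponent {n D : ℕ} (e : Fin n → Fin D) : Fin n →₀ ℕ :=
  Finsupp.equivFunOnFinite.symm fun i => (e i : ℕ)

/-- Entries of a box exponent. [folklore] -/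
@[simp] private theorem boxExponent_apply {n D : ℕ} (e : Fin n → Fin D) (i : Fin n) :
    boxExponent e i = e i := by
  simp [boxExponent]

/-- Distinct box vectors give distinct exponents. [folklore] -/
private theorem boxExponent_injective {n D : ℕ} : Function.Injective (boxExponent (n := n) (D := D)) := by
  intro e e' h
  funext i
  exact Fin.ext (by simpa using congrArg (fun f => f i) h)

/-- The combination `Σ_e c_e · x^e` of the box monomials with coefficient vector `c`.
[cite: ChatterjeeTengse2023, Lemma 3.2 (v1: Lemma 39)] -/
def boxPoly {n D : ℕ} (c : (Fin n → Fin D) → K) : MvPolynomial (Fin n) K :=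
  ∑ e, monomial (boxExponent e) (c e)

/-- The coefficient of `x^e` in `Σ_e c_e x^e` is `c_e`. [folklore] -/
private theorem coeff_boxPoly_boxExponent {n D : ℕ} (c : (Fin n → Fin D) → K) (e : Fin n → Fin D) :
    coeff (boxExponent e) (boxPoly c) = c e := by
  classical
  simp only [boxPoly, coeff_sum, coeff_monomial]
  rw [Finset.sum_eq_single e]
  · simp
  · intro e' _ hne
    simp [boxExponent_injective.ne hne]
  · simp

/-- A nonzero coefficient vector gives a nonzero polynomial. [folklore] -/
private theorem boxPoly_ne_zero {n D : ℕ} {c : (Fin n → Fin D) → K} (hc : c ≠ 0) : boxPoly c ≠ 0 := by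
  obtain ⟨e, he⟩ := Function.ne_iff.1 hc
  intro h
  apply he
  have := coeff_boxPoly_boxExponent c e
  rw [h, coeff_zero] at this
  exact this.symm

/-- `Σ_e c_e x^e` has individual degrees `< D` ("monomials … of individual degree at most `D-1`").
[cite: ChatterjeeTengse2023, Lemma 3.2 (v1: Lemma 39)] -/
theorem degreeOf_boxPoly_lt {n D : ℕ} (hD : 0 < D) (c : (Fin n → Fin D) → K) (j : Fin n) :
    (boxPoly c).degreeOf j < D := by
  classical
  rw [degreeOf_lt_iff hD]
  intro m hm
  simp only [boxPoly] at hm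
  obtain ⟨e, -, he⟩ := Finset.mem_biUnion.1 (Finset.mem_of_subset (support_sum) hm)
  rw [support_monomial] at he
  split_ifs at he with h0
  · simp at he
  · rw [Finset.mem_singleton] at he
    subst he
    simp

/-- `aeval G (Σ_e c_e x^e) = Σ_e c_e · ∏_i G_i^{e_i}`. [cite: ChatterjeeTengse2023, Lemma 3.2 (v1: Lemma 39)] -/
theorem aeval_boxPoly {n m D : ℕ} (G : Fin n → MvPolynomial (Fin m) K) (c : (Fin n → Fin D) → K) :
    aeval G (boxPoly c) = ∑ e, c e • ∏ i, G i ^ (e i : ℕ) := by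
  classical
  simp only [boxPoly, map_sum, aeval_monomial, Algebra.smul_def, algebraMap_eq]
  refine Finset.sum_congr rfl fun e _ => ?_
  congr 1
  rw [Finsupp.prod_fintype _ _ (by simp)]
  simp

/-- The total degree of `∏_i G_i^{e_i}` with `e_i < D` and `deg G_i ≤ d` is at most `n(D-1)d`.
[cite: ChatterjeeTengse2023, proof of Lemma 3.2 (v1: p0014.txt:L48–50)] -/
theorem totalDegree_prod_pow_le {n m d D : ℕ} (G : Fin n → MvPolynomial (Fin m) K)
    (hG : ∀ i, (G i).totalDegree ≤ d) (e : Fin n → Fin D) :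
    (∏ i, G i ^ (e i : ℕ)).totalDegree ≤ n * (D - 1) * d := by
  calc (∏ i, G i ^ (e i : ℕ)).totalDegree ≤ ∑ i, (G i ^ (e i : ℕ)).totalDegree :=
        totalDegree_finsetProd _ _
    _ ≤ ∑ _i : Fin n, (D - 1) * d := by
        refine Finset.sum_le_sum fun i _ => (totalDegree_pow _ _).trans ?_
        exact Nat.mul_le_mul (by have := (e i).isLt; omega) (hG i)
    _ = n * (D - 1) * d := by simp [mul_assoc]

/-- **Lemma 3.2, existence half (annihilator of bounded individual degree).** For a polynomial map
`G = (g_1, …, g_n) : K^m → K^n` of degree `≤ d` and any `D` with `(n(D−1)d + 1)^m < D^n` (the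
source's "`M` has fewer rows than columns … `(ndD)^m < D^n`", the rows being the monomials in
`z` of degree `≤ n(D−1)d` and the columns the monomials in `x` of individual degree `≤ D − 1`)
there is a nonzero annihilator `A(x_1, …, x_n)` of `G` of individual degree `< D`: "any nonzero
dependency in the columns of `M` is the coefficient vector of some annihilator of `G` … there is
a non-trivial dependency in its columns". PROVED (linear algebra: `finrank` of the coefficient
space `K^{D^n}` exceeds that of the target `K^{(n(D-1)d+1)^m}`), over every field.
[cite: ChatterjeeTengse2023, Lemma 3.2 (v1: Lemma 39)] locator: paper:arxiv-2309.07612 p0014.txt:L13–L52 -/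
theorem exists_annihilator_degreeOf_lt {m n d D : ℕ} (G : Fin n → MvPolynomial (Fin m) K)
    (hG : ∀ i, (G i).totalDegree ≤ d) (hD : (n * (D - 1) * d + 1) ^ m < D ^ n) :
    ∃ A : MvPolynomial (Fin n) K, A ≠ 0 ∧ (∀ j, A.degreeOf j < D) ∧ aeval G A = 0 := by
  classical
  have hD0 : 0 < D := by
    rcases Nat.eq_zero_or_pos D with h | h
    · subst h
      rcases Nat.eq_zero_or_pos n with hn | hn
      · subst hn; simp at hD
      · rw [zero_pow hn.ne'] at hD; exact absurd hD (Nat.not_lt_zero _)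
    · exact h
  set T := n * (D - 1) * d with hT
  -- the linear map: coefficient vector ↦ low coefficients of `Σ c_e ∏ G^e`
  let Φ : ((Fin n → Fin D) → K) →ₗ[K] ((Fin m → Fin (T + 1)) → K) :=
    { toFun := fun c r => coeff (boxExponent r) (aeval G (boxPoly c))
      map_add' := by
        intro c c'
        funext r
        simp only [Pi.add_apply]
        rw [show boxPoly (c + c') = boxPoly c + boxPoly c' by
          simp [boxPoly, Finset.sum_add_distrib], map_add, coeff_add]
      map_smul' := by
        intro a c
        funext r
        simp only [Pi.smul_apply, RingHom.id_apply, smul_eq_mul]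
        rw [show boxPoly (a • c) = a • boxPoly c by
          simp [boxPoly, Finset.smul_sum, smul_monomial], map_smul, coeff_smul, smul_eq_mul] }
  have hrank : Module.finrank K ((Fin m → Fin (T + 1)) → K) <
      Module.finrank K ((Fin n → Fin D) → K) := by
    simpa [Module.finrank_fintype_fun_eq_card, Fintype.card_fun, Fintype.card_fin] using hD
  obtain ⟨c, hcker, hc0⟩ : ∃ c ∈ LinearMap.ker Φ, c ≠ 0 :=
    Submodule.exists_mem_ne_zero_of_ne_bot (LinearMap.ker_ne_bot_of_finrank_lt hrank)
  refine ⟨boxPoly c, boxPoly_ne_zero hc0, degreeOf_boxPoly_lt hD0 c, ?_⟩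
  -- every coefficient of `aeval G (boxPoly c)` vanishes: low ones by `hcker`, high ones by degree
  have hdeg : (aeval G (boxPoly c)).totalDegree ≤ T := by
    rw [aeval_boxPoly]
    refine (totalDegree_finsetSum _ _).trans (Finset.sup_le fun e _ => ?_)
    exact (totalDegree_smul_le _ _).trans (totalDegree_prod_pow_le G hG e)
  rw [LinearMap.mem_ker] at hcker
  ext e'
  rw [coeff_zero]
  by_cases he' : e' ∈ (aeval G (boxPoly c)).support
  · have hle : ∀ j, e' j ≤ T := fun j =>
      (Finsupp.le_degree j e').trans ((le_totalDegree he').trans hdeg)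
    let r : Fin m → Fin (T + 1) := fun j => ⟨e' j, Nat.lt_succ_of_le (hle j)⟩
    have hr : boxExponent r = e' := by ext j; simp [r]
    have := congrArg (fun f => f r) hcker
    simpa [Φ, hr] using this
  · simpa [mem_support_iff] using he'

/-- **Lemma 3.2 at the parameters of Thm. 3.1** ("with `n ≥ 2m` … individual degree at most
`3·m·d`"): a polynomial map with at least twice as many outputs as inputs, `d ≥ 1`, `m ≥ 1`, has a
nonzero annihilator of individual degree `≤ n·d` — from `exists_annihilator_degreeOf_lt` with
`D = nd + 1`, since `(n·(nd)·d + 1)^m < ((nd+1)²)^m = (nd+1)^{2m} ≤ (nd+1)^n`. (Restricting `G` to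
its first `2m` outputs first, as the source does, gives the printed `2md ≤ 3md`.)
[cite: ChatterjeeTengse2023, Lemma 3.2 and Thm. 3.1 (v1: Lemma 39, §3)] locator: paper:arxiv-2309.07612 p0014.txt:L6–L10 -/
theorem exists_annihilator_degreeOf_le_of_two_mul_le {m n d : ℕ} (hm : 1 ≤ m) (hd : 1 ≤ d)
    (hn : 2 * m ≤ n) (G : Fin n → MvPolynomial (Fin m) K) (hG : ∀ i, (G i).totalDegree ≤ d) :
    ∃ A : MvPolynomial (Fin n) K, A ≠ 0 ∧ (∀ j, A.degreeOf j ≤ n * d) ∧ aeval G A = 0 := by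
  have hnd : 1 ≤ n * d := Nat.one_le_iff_ne_zero.2 (Nat.mul_ne_zero (by omega) (by omega))
  have key : (n * (n * d + 1 - 1) * d + 1) ^ m < (n * d + 1) ^ n := by
    rw [Nat.add_sub_cancel]
    calc (n * (n * d) * d + 1) ^ m < ((n * d + 1) ^ 2) ^ m := by
          apply Nat.pow_lt_pow_left _ (by omega)
          nlinarith
      _ = (n * d + 1) ^ (2 * m) := by rw [← pow_mul, mul_comm]
      _ ≤ (n * d + 1) ^ n := Nat.pow_le_pow_right (by omega) hn
  obtain ⟨A, hA0, hAdeg, hA⟩ := exists_annihilator_degreeOf_lt G hG key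
  exact ⟨A, hA0, fun j => Nat.lt_succ_iff.1 (hAdeg j), hA⟩

/-- **Lemma 3.2 / Thm. 3.1 with the printed bound `3·m·d`.** For `m, d ≥ 1` and `n ≥ 2m`, a
degree-`≤ d` polynomial map `𝔽^m → 𝔽^n` has a nonzero annihilator of individual degree at most
`3md` — the source's route: restrict to the first `2m` outputs ("`A(x_1, …, x_n) := A'(x_1, …, x_{2m})`",
end of the proof of Thm. 3.1), where the previous lemma gives individual degree `≤ 2m·d ≤ 3md`.
This is the EXISTENCE content of Thm. 3.1; its size bound for a projection circuit computing `A`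
is the named fact `CT23_thm_3_1`. PROVED over every field.
[cite: ChatterjeeTengse2023, Lemma 3.2 and Thm. 3.1 (v1: Lemma 39; p0016.txt:L25)] -/
theorem exists_annihilator_degreeOf_le_three_mul {m n d : ℕ} (hm : 1 ≤ m) (hd : 1 ≤ d)
    (hn : 2 * m ≤ n) (G : Fin n → MvPolynomial (Fin m) K) (hG : ∀ i, (G i).totalDegree ≤ d) :
    ∃ A : MvPolynomial (Fin n) K, A ≠ 0 ∧ (∀ j, A.degreeOf j ≤ 3 * m * d) ∧ aeval G A = 0 := by
  classical
  have hι : Function.Injective (Fin.castLE hn) := Fin.castLE_injective hn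
  obtain ⟨A', h0, hdeg, hA'⟩ := exists_annihilator_degreeOf_le_of_two_mul_le (K := K) hm hd le_rfl
    (G ∘ Fin.castLE hn) fun i => hG _
  refine ⟨rename (Fin.castLE hn) A', ?_, fun j => ?_, ?_⟩
  · intro h
    exact h0 (rename_injective _ hι (by rw [h, map_zero]))
  · rw [degreeOf_le_iff]
    intro m' hm'
    rw [support_rename_of_injective hι, Finset.mem_image] at hm'
    obtain ⟨u, hu, rfl⟩ := hm'
    by_cases hj : j ∈ Set.range (Fin.castLE hn)
    · obtain ⟨i, rfl⟩ := hj
      rw [Finsupp.mapDomain_apply hι]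
      exact (monomial_le_degreeOf i hu).trans ((hdeg i).trans (by nlinarith))
    · rw [Finsupp.mapDomain_notin_range _ _ hj]
      exact Nat.zero_le _
  · rw [aeval_rename]
    exact hA'

end Annihilator


/-! ### §4.2: the interpolating set `I_{n,d}` and evaluation vectors (Def. 4.3, Prop. 4.4, Def. 4.5) -/

section Evaluation

variable (F : Type u) [Field F]

/-- **The interpolating set `I_{n,d}`** (Prop. 4.4 [BP20, Thm. 10]): "Let `S := {0,1,2,…,d}`,
then the set of evaluation points `I_{n,d} := {(a_1, …, a_n) ∈ S^n | a_1 + ⋯ + a_n ≤ d}`" — as a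
set of vectors of naturals (the condition `a_i ≤ d` is implied by the sum condition).
[cite: ChatterjeeTengse2023, Prop. 4.4 (v1: Prop. 47)] locator: paper:arxiv-2309.07612 p0017.txt:L45 -/
def simplexPoints (n d : ℕ) : Set (Fin n → ℕ) :=
  {a | ∑ i, a i ≤ d}

/-- The point `(m_1, …, m_n) ∈ F^n` attached to an exponent vector `m`; for `|m| ≤ d` these are
exactly the points of `I_{n,d}` read in `F` (`mem_simplexPoints_iff`), which is how this file
INDEXES `I_{n,d}`: by the monomials of degree `≤ d` (the source: "The order can be picked
arbitrarily", footnote to Def. 4.5). [cite: ChatterjeeTengse2023, Def. 4.5 (v1: Def. 48)] -/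
def exponentPoint {n : ℕ} (m : Fin n →₀ ℕ) : Fin n → F :=
  fun i => ((m i : ℕ) : F)

omit [Field F] in
/-- `(m_i)_i ∈ I_{n,d}` iff `|m| ≤ d`. [cite: ChatterjeeTengse2023, Prop. 4.4 (v1: Prop. 47)] -/
theorem mem_simplexPoints_iff {n d : ℕ} (m : Fin n →₀ ℕ) :
    (⇑m) ∈ simplexPoints n d ↔ m ∈ monomialsDegLE n d := by
  change (∑ i, m i ≤ d) ↔ m.degree ≤ d
  rw [Finsupp.degree_eq_sum]

/-- **Def. 4.5 (evaluation vector).** "For any `n`-variate polynomial `f(x)` of total degree-`d`,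
its evaluation vector is simply the vector formed by evaluations of `f` on the set `I_{n,d}`",
indexed by the monomials `x^{≤ d}` (`monomialsDegLE n d`, the tree's coefficient-vector index set;
at `d = n` this is `degLEMonomials n`) through `m ↦ (m_1, …, m_n)`.
[cite: ChatterjeeTengse2023, Def. 4.5 (v1: Def. 48)] locator: paper:arxiv-2309.07612 p0017.txt:L48 -/
def evalVector {n : ℕ} (d : ℕ) (f : MvPolynomial (Fin n) F) : monomialsDegLE n d → F :=
  fun m => eval (exponentPoint F (m : Fin n →₀ ℕ)) f

/-- Unfolding of the evaluation vector. [cite: ChatterjeeTengse2023, Def. 4.5 (v1: Def. 48)] -/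
theorem evalVector_apply {n d : ℕ} (f : MvPolynomial (Fin n) F) (m : monomialsDegLE n d) :
    evalVector F d f m = eval (exponentPoint F (m : Fin n →₀ ℕ)) f := rfl

/-- **Prop. 4.4, the content of "interpolating" (a polynomial of degree `≤ d` vanishing on `I_{n,d}`
is zero).** Over a field of characteristic `0`. Proof: a top-degree monomial `x^t` of `f ≠ 0`
(`|t| = deg f ≤ d`, coefficient `≠ 0`) and Alon's Combinatorial Nullstellensatz on the box
`∏_i {0, …, t_i} ⊆ I_{n,d}` give a point of the box, hence of the simplex, where `f ≠ 0`.
[cite: ChatterjeeTengse2023, Prop. 4.4 (v1: Prop. 47)] locator: paper:arxiv-2309.07612 p0017.txt:L45 -/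
theorem eq_zero_of_forall_eval_exponentPoint_eq_zero [CharZero F] {n d : ℕ}
    (f : MvPolynomial (Fin n) F) (hf : f.totalDegree ≤ d)
    (h : ∀ m : Fin n →₀ ℕ, m ∈ monomialsDegLE n d → eval (exponentPoint F m) f = 0) : f = 0 := by
  classical
  by_contra hne
  obtain ⟨t, ht, htop⟩ :=
    Finset.exists_mem_eq_sup f.support (support_nonempty.2 hne) fun s => s.sum fun _ e => e
  have hcoeff : f.coeff t ≠ 0 := mem_support_iff.1 ht
  have hdeg : f.totalDegree = t.degree := by
    rw [totalDegree, htop, Finsupp.degree]; rfl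
  let S : Fin n → Finset F := fun i => (Finset.range (t i + 1)).image (Nat.cast : ℕ → F)
  have hS : ∀ i, t i < (S i).card := fun i => by
    simp only [S]
    rw [Finset.card_image_of_injective _ Nat.cast_injective, Finset.card_range]
    exact Nat.lt_succ_self _
  obtain ⟨s, hs, hne0⟩ := combinatorial_nullstellensatz_exists_eval_nonzero f t hcoeff hdeg S hS
  have hs' : ∀ i, ∃ a : ℕ, a ≤ t i ∧ (a : F) = s i := fun i => by
    obtain ⟨a, ha, ha'⟩ := Finset.mem_image.1 (hs i)
    exact ⟨a, by simpa [Nat.lt_succ_iff] using ha, ha'⟩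
  choose a ha using hs'
  let m : Fin n →₀ ℕ := Finsupp.equivFunOnFinite.symm a
  have hm : m ∈ monomialsDegLE n d := by
    change m.degree ≤ d
    rw [Finsupp.degree_eq_sum]
    calc ∑ i, m i = ∑ i, a i := by simp [m]
      _ ≤ ∑ i, t i := Finset.sum_le_sum fun i _ => (ha i).1
      _ = t.degree := (Finsupp.degree_eq_sum t).symm
      _ ≤ d := hdeg ▸ hf
  have hpt : exponentPoint F m = s := by
    funext i
    simp [exponentPoint, m, (ha i).2]
  exact hne0 (hpt ▸ h m hm)

/-- Prop. 4.4, injectivity form: two polynomials of degree `≤ d` with the same evaluation vector on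
`I_{n,d}` are equal. [cite: ChatterjeeTengse2023, Prop. 4.4 (v1: Prop. 47)] -/
theorem evalVector_injOn [CharZero F] (n d : ℕ) :
    Set.InjOn (evalVector F (n := n) d) {f | f.totalDegree ≤ d} := by
  intro f hf g hg hfg
  rw [← sub_eq_zero]
  refine eq_zero_of_forall_eval_exponentPoint_eq_zero F (f - g)
    ((totalDegree_sub f g).trans (max_le hf hg)) fun m hm => ?_
  have := congrArg (fun v => v ⟨m, hm⟩) hfg
  simp only [evalVector] at this
  rw [map_sub, this, sub_self]

/-- The "Vandermonde" matrix of `I_{n,d}`: entry `(m, m') = (exponent point of m)^{m'}`, so that the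
evaluation vector is this matrix applied to the coefficient vector (`evalVector_eq_mulVec`).
[cite: ChatterjeeTengse2023, Def. 4.3 (v1: Def. 46)] -/
def simplexVandermonde (n d : ℕ) [Fintype (monomialsDegLE n d)] :
    Matrix (monomialsDegLE n d) (monomialsDegLE n d) F :=
  fun m m' => ∏ i, exponentPoint F (m : Fin n →₀ ℕ) i ^ (m' : Fin n →₀ ℕ) i

/-- Evaluation through the coefficient vector: for `deg f ≤ d`,
`evalVector f = V · coeffVector f` with `V` the Vandermonde matrix of `I_{n,d}` ("we can move
between its coefficient vector and evaluation vector using linear transformations", proof of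
Prop. 4.6). [cite: ChatterjeeTengse2023, Prop. 4.4 and proof of Prop. 4.6 (v1: Prop. 47, 49)] -/
theorem evalVector_eq_mulVec {n d : ℕ} [Fintype (monomialsDegLE n d)] {f : MvPolynomial (Fin n) F}
    (hf : f.totalDegree ≤ d) :
    evalVector F d f = (simplexVandermonde F n d).mulVec (coeffVector (monomialsDegLE n d) f) := by
  classical
  funext m
  rw [evalVector_apply, eval_eq]
  simp only [Matrix.mulVec, dotProduct]
  -- enlarge the sum over the support to the sum over `x^{≤ d}`
  have hsub : f.support ⊆
      (Finset.univ : Finset (monomialsDegLE n d)).map (Function.Embedding.subtype _) := by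
    intro m' hm'
    have : m' ∈ monomialsDegLE n d := by
      change m'.degree ≤ d
      rw [Finsupp.degree_apply]
      exact (le_totalDegree hm').trans hf
    exact Finset.mem_map.mpr ⟨⟨m', this⟩, Finset.mem_univ _, rfl⟩
  rw [Finset.sum_subset hsub, Finset.sum_map]
  · refine Finset.sum_congr rfl fun μ _ => ?_
    rw [Function.Embedding.coe_subtype, coeffVector_apply, simplexVandermonde, mul_comm]
    congr 1
    exact Finset.prod_subset (Finset.subset_univ _) fun i _ hi => by
      rw [Finsupp.notMem_support_iff.1 hi, pow_zero]
  · intro m' _ hm'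
    rw [notMem_support_iff.mp hm', zero_mul]

/-- The Vandermonde matrix of `I_{n,d}` is invertible (Prop. 4.4: the points `I_{n,d}` interpolate
degree-`≤ d` polynomials). [cite: ChatterjeeTengse2023, Prop. 4.4 (v1: Prop. 47)] -/
theorem isUnit_det_simplexVandermonde [CharZero F] (n d : ℕ) [Fintype (monomialsDegLE n d)] :
    IsUnit (simplexVandermonde F n d).det := by
  classical
  rw [isUnit_iff_ne_zero, Ne, ← Matrix.exists_mulVec_eq_zero_iff]
  rintro ⟨c, hc0, hc⟩
  apply hc0
  -- the polynomial with coefficient vector `c`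
  set f : MvPolynomial (Fin n) F := ∑ μ : monomialsDegLE n d, monomial (μ : Fin n →₀ ℕ) (c μ)
    with hfdef
  have hcoeff : ∀ μ : monomialsDegLE n d, coeff (μ : Fin n →₀ ℕ) f = c μ := fun μ => by
    rw [hfdef, coeff_sum, Finset.sum_eq_single μ]
    · simp
    · intro μ' _ hne
      rw [coeff_monomial, if_neg]
      exact fun h => hne (Subtype.ext h)
    · simp
  have hsupp : ∀ m ∈ f.support, m ∈ monomialsDegLE n d := fun m hm => by
    rw [hfdef] at hm
    obtain ⟨μ, -, hμ⟩ := Finset.mem_biUnion.1 (Finset.mem_of_subset support_sum hm)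
    rw [support_monomial] at hμ
    split_ifs at hμ
    · simp at hμ
    · rw [Finset.mem_singleton] at hμ
      exact hμ ▸ μ.2
  have hf : f.totalDegree ≤ d := by
    rw [totalDegree]
    refine Finset.sup_le fun m hm => ?_
    have := hsupp m hm
    change m.degree ≤ d at this
    rwa [Finsupp.degree] at this
  have hcv : coeffVector (monomialsDegLE n d) f = c := funext fun μ => by
    rw [coeffVector_apply, hcoeff]
  have hzero : f = 0 := by
    refine eq_zero_of_forall_eval_exponentPoint_eq_zero F f hf fun m hm => ?_
    have := congrArg (fun v => v ⟨m, hm⟩) (evalVector_eq_mulVec F hf)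
    simpa [evalVector_apply, hcv, hc] using this
  funext μ
  rw [← hcoeff μ, hzero, coeff_zero, Pi.zero_apply]

/-- **Prop. 4.4 as printed** ("there is a linear transformation `M` such that for any polynomial
`f ∈ P`, the coefficients of `f` can be obtained from the evaluations of `f` on the set `I` by an
application of `M`"), `P` = polynomials of total degree `≤ d`, `I = I_{n,d}`; here `M = V⁻¹`.
PROVED over fields of characteristic `0` (false in small positive characteristic, e.g. `x^p - x`).
[cite: ChatterjeeTengse2023, Def. 4.3 and Prop. 4.4 = BlaserPandey 2020 Thm. 10 (v1: Def. 46, Prop. 47)]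
locator: paper:arxiv-2309.07612 p0017.txt:L42–L46 -/
theorem CT23_prop_4_4 [CharZero F] (n d : ℕ) [Fintype (monomialsDegLE n d)] :
    ∃ M : Matrix (monomialsDegLE n d) (monomialsDegLE n d) F,
      ∀ f : MvPolynomial (Fin n) F, f.totalDegree ≤ d →
        M.mulVec (evalVector F d f) = coeffVector (monomialsDegLE n d) f := by
  classical
  refine ⟨(simplexVandermonde F n d)⁻¹, fun f hf => ?_⟩
  rw [evalVector_eq_mulVec F hf, Matrix.mulVec_mulVec,
    Matrix.nonsing_inv_mul _ (isUnit_det_simplexVandermonde F n d), Matrix.one_mulVec]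

end Evaluation


/-! ### Prop. 4.6: equations for evaluation vectors versus equations for coefficient vectors -/

section EvalVsCoeff

variable (F : Type u) [Field F]

/-- Evaluating a linear substitution: `(A · p)(y) = p((∑_j A_{ji} y_j)_i)`. [folklore] -/
private theorem eval_linSubst {S : Type*} [Fintype S] (A : Matrix S S F) (y : S → F)
    (p : MvPolynomial S F) :
    eval y (linSubst S F A p) = eval (fun i => ∑ j, A j i * y j) p := by
  have h : linSubst S F A p = bind₁ (fun i => ∑ j, A j i • (X j : MvPolynomial S F)) p := by
    simp [linSubst, aeval_eq_bind₁]
  rw [h]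
  change eval₂Hom (RingHom.id F) y (bind₁ _ p) = _
  rw [eval₂Hom_bind₁]
  change eval (fun i => eval y (∑ j, A j i • (X j : MvPolynomial S F))) p = _
  have hfun : (fun i => eval y (∑ j, A j i • (X j : MvPolynomial S F))) = fun i => ∑ j, A j i * y j := by
    funext i
    simp [smul_eval]
  rw [hfun]

/-- A linear substitution by an invertible matrix is injective on polynomials. [folklore] -/
private theorem linSubst_injective {S : Type*} [Fintype S] [DecidableEq S] (A : Matrix S S F)
    (hA : IsUnit A.det) : Function.Injective (linSubst S F A) := by
  intro x y hxy
  have := congrArg (linSubst S F A⁻¹) hxy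
  simp only [← AlgHom.comp_apply, ← linSubst_mul, Matrix.nonsing_inv_mul _ hA, linSubst_one,
    AlgHom.id_apply] at this
  exact this

/-- Cost of a linear substitution: `L(A · p) ≤ L(p) + 2|S|²` (each of the `|S|` linear forms
`∑_j A_{ji} x_j` costs `≤ 2|S|` gates; the source: "both these transformations have
(constant-free) algebraic circuits of size `poly(N)`"). [cite: ChatterjeeTengse2023, proof of Prop. 4.6 (v1: Prop. 49)] -/
theorem complexity_linSubst_le {S : Type*} [Fintype S] (A : Matrix S S F) (p : MvPolynomial S F) :
    complexity (linSubst S F A p) ≤ complexity p + 2 * Fintype.card S ^ 2 := by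
  classical
  have h1 : ∀ i, complexity (∑ j, A j i • (X j : MvPolynomial S F)) ≤ 2 * Fintype.card S := by
    intro i
    calc complexity (∑ j, A j i • (X j : MvPolynomial S F))
        ≤ ∑ j, complexity (A j i • (X j : MvPolynomial S F)) + (Finset.univ : Finset S).card :=
          complexity_finset_sum_le _ _
      _ ≤ ∑ _j : S, 1 + (Finset.univ : Finset S).card := by
          gcongr with j
          calc complexity (A j i • (X j : MvPolynomial S F)) ≤ complexity (X j : MvPolynomial S F) + 1 :=
                complexity_smul_le_holds _ _
            _ = 1 := by rw [complexity_X_holds]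
      _ = 2 * Fintype.card S := by simp [two_mul]
  have h0 : linSubst S F A p = aeval (fun i => ∑ j, A j i • (X j : MvPolynomial S F)) p := by
    simp [linSubst]
  calc complexity (linSubst S F A p)
      ≤ complexity p + ∑ i, complexity (∑ j, A j i • (X j : MvPolynomial S F)) := by
        rw [h0]; exact complexity_aeval_le _ _
    _ ≤ complexity p + ∑ _i : S, 2 * Fintype.card S := by
        gcongr with i
        exact h1 i
    _ = complexity p + 2 * Fintype.card S ^ 2 := by simp [sq]; ring

/-- `(A · p)(y) = p(Aᵀ y)` in matrix form. [folklore] -/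
private theorem eval_linSubst_transpose {S : Type*} [Fintype S] (M : Matrix S S F) (y : S → F)
    (p : MvPolynomial S F) : eval y (linSubst S F M.transpose p) = eval (M.mulVec y) p := by
  rw [eval_linSubst]
  congr 1

/-- **Prop. 4.6, coefficient equations ⇒ evaluation equations** (`VP`-size form). If a nonzero
`D` of complexity `L(D)` vanishes on the coefficient vectors of a class `𝒞` of polynomials of
degree `≤ d`, then `E := D ∘ V⁻¹` (with `V` the Vandermonde matrix of `I_{n,d}`) is nonzero, has
`deg E ≤ deg D`, `L(E) ≤ L(D) + 2N²` (`N = |x^{≤ d}| = |I_{n,d}|`), and vanishes on the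
EVALUATION vectors of `𝒞` — "we can move between its coefficient vector and evaluation vector
using linear transformations … (constant-free) algebraic circuits of size `poly(N)`". The source
states this for the classes `VP`, `VNP` of families; typed here per `n` with explicit bounds (the
`VNP` variant is not typed). [cite: ChatterjeeTengse2023, Prop. 4.6 and Prop. 1.6 (v1: Prop. 49, Prop. 4)]
locator: paper:arxiv-2309.07612 p0017.txt:L50–L56 -/
theorem exists_evalEquation_of_coeffEquation [CharZero F] {n d : ℕ} [Fintype (monomialsDegLE n d)]
    (𝒞 : Set (MvPolynomial (Fin n) F)) (h𝒞 : ∀ f ∈ 𝒞, f.totalDegree ≤ d)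
    {D : MvPolynomial (monomialsDegLE n d) F} (hD0 : D ≠ 0)
    (hD : ∀ f ∈ 𝒞, eval (coeffVector (monomialsDegLE n d) f) D = 0) :
    ∃ E : MvPolynomial (monomialsDegLE n d) F, E ≠ 0 ∧ E.totalDegree ≤ D.totalDegree ∧
      complexity E ≤ complexity D + 2 * Fintype.card (monomialsDegLE n d) ^ 2 ∧
      ∀ f ∈ 𝒞, eval (evalVector F d f) E = 0 := by
  classical
  have hV := isUnit_det_simplexVandermonde F n d
  set M := (simplexVandermonde F n d)⁻¹ with hM
  have hMt : IsUnit M.transpose.det :=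
    Matrix.isUnit_det_transpose _ (Matrix.isUnit_nonsing_inv_det _ hV)
  refine ⟨linSubst _ F M.transpose D, ?_, totalDegree_linSubst_le_holds _ _,
    complexity_linSubst_le F _ _, fun f hf => ?_⟩
  · intro h
    exact hD0 (linSubst_injective F M.transpose hMt (by rw [h, map_zero]))
  · rw [eval_linSubst_transpose, evalVector_eq_mulVec F (h𝒞 f hf), Matrix.mulVec_mulVec, hM,
      Matrix.nonsing_inv_mul _ hV, Matrix.one_mulVec]
    exact hD f hf

/-- **Prop. 4.6, evaluation equations ⇒ coefficient equations** (`VP`-size form): conversely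
`D := E ∘ V` is a nonzero equation for the coefficient vectors, `deg D ≤ deg E`,
`L(D) ≤ L(E) + 2N²`. [cite: ChatterjeeTengse2023, Prop. 4.6 and Prop. 1.6 (v1: Prop. 49, Prop. 4)]
locator: paper:arxiv-2309.07612 p0017.txt:L50–L56 -/
theorem exists_coeffEquation_of_evalEquation [CharZero F] {n d : ℕ} [Fintype (monomialsDegLE n d)]
    (𝒞 : Set (MvPolynomial (Fin n) F)) (h𝒞 : ∀ f ∈ 𝒞, f.totalDegree ≤ d)
    {E : MvPolynomial (monomialsDegLE n d) F} (hE0 : E ≠ 0)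
    (hE : ∀ f ∈ 𝒞, eval (evalVector F d f) E = 0) :
    ∃ D : MvPolynomial (monomialsDegLE n d) F, D ≠ 0 ∧ D.totalDegree ≤ E.totalDegree ∧
      complexity D ≤ complexity E + 2 * Fintype.card (monomialsDegLE n d) ^ 2 ∧
      ∀ f ∈ 𝒞, eval (coeffVector (monomialsDegLE n d) f) D = 0 := by
  classical
  set V := simplexVandermonde F n d with hVdef
  have hVt : IsUnit V.transpose.det :=
    Matrix.isUnit_det_transpose _ (isUnit_det_simplexVandermonde F n d)
  refine ⟨linSubst _ F V.transpose E, ?_, totalDegree_linSubst_le_holds _ _,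
    complexity_linSubst_le F _ _, fun f hf => ?_⟩
  · intro h
    exact hE0 (linSubst_injective F V.transpose hVt (by rw [h, map_zero]))
  · rw [eval_linSubst_transpose, hVdef, ← evalVector_eq_mulVec F (h𝒞 f hf)]
    exact hE f hf

/-- At `d = n` the index set is the tree's `degLEMonomials n` (`monomialsDegLE_self`), so Prop. 4.6
reads directly on FSV natural proofs (`IsNaturalProof (degLEMonomials n) 𝒞 𝒟 D`): a natural proof
against a class of degree-`≤ n` polynomials yields a nonzero equation for their EVALUATION vectors
with `L(E) ≤ L(D) + 2N²`, `deg E ≤ deg D`, `N = binom(2n, n)`.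
[cite: ChatterjeeTengse2023, Prop. 4.6 (v1: Prop. 49)] -/
theorem exists_evalEquation_of_isNaturalProof [CharZero F] {n : ℕ}
    {𝒞 : Set (MvPolynomial (Fin n) F)} (h𝒞 : ∀ f ∈ 𝒞, f.totalDegree ≤ n)
    {𝒟 : Set (MvPolynomial (degLEMonomials n) F)} {D : MvPolynomial (degLEMonomials n) F}
    (hD : IsNaturalProof (degLEMonomials n) 𝒞 𝒟 D) :
    ∃ E : MvPolynomial (degLEMonomials n) F, E ≠ 0 ∧ E.totalDegree ≤ D.totalDegree ∧
      complexity E ≤ complexity D + 2 * Fintype.card (degLEMonomials n) ^ 2 ∧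
      ∀ f ∈ 𝒞, eval (evalVector F n f) E = 0 := by
  classical
  exact @exists_evalEquation_of_coeffEquation F _ _ n n (degLEMonomials.instFintype n) 𝒞 h𝒞 D
    hD.2.1 hD.2.2

end EvalVsCoeff


/-! ### The named facts: Thm. 3.1 (annihilators of explicit maps) and Lemma 4.7 (equations for
the evaluation vectors of `VP` by constant-free projection circuits) -/

section Facts

-- FACT (R1: the source's `VPSPACE` succinct-determinant construction, §2.4 and §3.2, is not in the tree)
/-- **CT23 Thm. 3.1 [Annihilators of explicit maps].** "Let `m` be large enough, and let
`G : 𝔽^m → 𝔽^n` be a polynomial map given by `(g_1(z), …, g_n(z))` of degree `d`, with `n ≥ 2m`.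
There exists a constant `c` such that, if there is a circuit with projection gates `C_G(z, y)` of
size `s` that encodes `G` as per Def. 1.7, then there is a circuit with projection gates `C'(x)`
of size `(m·d·s)^c` computing a nonzero polynomial `A(x)` of individual degree at most `3·m·d`
that annihilates `G` (that is, `A ∘ G_m = A(g_1(z), …, g_n(z)) ≡ 0`)."
Rendering: `𝔽` a field of characteristic `0` (module docstring, "Field"); circuits with
projection gates = `ProjCircuit` (fan-in two, size = number of gates; the source's wire count
differs by a factor `≤ 3`, absorbed in `c` — for this reason and to exclude the degenerate reading
the typed statement asks `2 ≤ s`); "of degree `d`" = every `g_i` has total degree `≤ d`, with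
`1 ≤ d` made explicit (at `d = 0` the printed bound "individual degree `≤ 3md = 0`" would force a
nonzero CONSTANT annihilator, which is absurd — the degenerate case is not meant); the quantifier
"`m` large enough … there exists a constant `c`" is rendered `∃ c m₀` AFTER the field (weakest
reading); both circuits may use BOUND WORKSPACE VARIABLES beyond their free variables (`⊕ Fin w`
for the encoder, `⊕ Fin t`, `t ≤ (mds)^c`, for `C'(x)`; the computed polynomial is the free-variable
polynomial read in the bigger ring, `rename Sum.inl`) — the source's `C'(x)` names free variables
only and its §3.2 construction sums over `poly(m,d,s)` bound bit-variables. ERRATUM (same seat):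
the first accepted text (p515197) omitted the workspace, a statement STRONGER than the source's;
corrected here in place (no dependents). The existence of SOME nonzero annihilator of individual
degree `≤ 2md ≤ 3md` (the Lemma 3.2 half) is PROVED above
(`exists_annihilator_degreeOf_le_of_two_mul_le`); the fact is the size bound for a projection
circuit computing one.
CONSUMER (route BarrierLever): applied to the evaluation (or coefficient) map of the tree's
universal circuit (`RazUniversal.exists_universalCircuit`, the generator behind
`FSV2018_lemma13`), it conditions a "`VPSPACE`-definable equations for `VP_n(n^b)`" rung below
`stmt-ValiantsHypothesis-8745` `DefinableEquations` / `stmt-ValiantsHypothesis-8749`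
`SingleSizeEquations` (equations of projection-circuit size `poly(n)` and individual degree
`poly(n)`, versus the Boolean sums of size `poly(N)` those items ask for).
[cite: ChatterjeeTengse2023, Thm. 3.1 (v1: Theorem "Annihilators of explicit maps", §3)]
locator: paper:arxiv-2309.07612 p0014.txt:L6–L10 -/
def CT23_thm_3_1 : Prop :=
  ∀ (F : Type) [Field F] [CharZero F], ∃ c m₀ : ℕ,
    ∀ (m n d s r w : ℕ) (G : Fin n → MvPolynomial (Fin m) F) (U : MvPolynomial (Fin m ⊕ Fin r) F)
      (Q : ProjCircuit F ((Fin m ⊕ Fin r) ⊕ Fin w)),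
      m₀ ≤ m → 2 * m ≤ n → 1 ≤ d → 2 ≤ s → (∀ i, (G i).totalDegree ≤ d) →
      Q.IsFanInTwo → Q.Computes (rename Sum.inl U) → Q.size ≤ s → Encodes U G →
        ∃ (t : ℕ) (A : MvPolynomial (Fin n) F) (Q' : ProjCircuit F (Fin n ⊕ Fin t)),
          A ≠ 0 ∧ (∀ j, A.degreeOf j ≤ 3 * m * d) ∧ aeval G A = 0 ∧
            Q'.IsFanInTwo ∧ Q'.Computes (rename Sum.inl A) ∧ t ≤ (m * d * s) ^ c ∧
              Q'.size ≤ (m * d * s) ^ c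

-- FACT (R1: Thm. 3.1 applied to the constant-free universal circuit; the `VPSPACE` construction is not in the tree)
/-- **CT23 Lemma 4.7 (equations for the evaluation vectors of `VP`, by constant-free circuits with
projection gates).** "There exists a constant `c`, such that for all large enough `n, d, s ∈ ℕ`,
a multilinear equation for the evaluation vectors of the set of `n`-variate, degree-`d`
polynomials computable by circuits of size `s`, is computable by constant-free circuits with
projection gates of size at most `(nds)^c`."
Rendering: the equation is an INTEGER polynomial `P ≠ 0` (constant-free circuits compute integer
polynomials) in the variables `x^{≤ d}` indexing `I_{n,d}` (`evalVector`), multilinear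
(every variable of degree `≤ 1`), computed by a constant-free (`HasSignConstants`) fan-in-two `ProjCircuit` over
`ℤ` of size `≤ (nds)^c`, and vanishing — read in `F` — at the evaluation vector of every
`f ∈ F[x_1, …, x_n]` with `deg f ≤ d` and `complexity f ≤ s` (the tree's fan-in-two gate count for
"circuits of size `s`"; the wire/gate and fan-in conventions change `s` by a constant factor,
absorbed in `c`); `F` of characteristic `0`; the circuit may use `t ≤ (nds)^c` BOUND WORKSPACE
VARIABLES (`⊕ Fin t`, computing `rename Sum.inl P`), as the source's circuits do; "for all large
enough `n, d, s`" = one threshold `N₀` TOGETHER WITH THE REGIME HYPOTHESIS THE PRINTED PROOF USES,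
`(nds)^c ≤ binom(n+d, d)` (the number `N` of evaluation points dominates the parameter count,
degree and size of the universal circuit, all `poly(n,d,s)` — "let `N = binom(n+d, n)` and consider
the universal circuit", the annihilator of Lemma 3.2 needing `N ≥ 2r` outputs); the constant `c`
and the threshold are allowed to depend on `F`, and `P` on `(F, n, d, s)` (weakest reading).
ERRATUM (same seat; `not_CT23_lemma_4_7_asPrinted` below): read with its printed quantifiers and
NO relation between `s` and `N`, Lemma 4.7 is FALSE — for `n, d` at the threshold and
`s ≥ #x^{≤ d}·(2d+2)` every degree-`≤ d` polynomial has complexity `≤ s` and the evaluation map is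
onto `F^{I_{n,d}}`, so no nonzero `P` vanishes on all evaluation vectors; the first accepted text
(p515197) typed that reading (and without workspace); corrected here in place (no dependents).
CONSUMER (route BarrierLever): with `d = n`, `s = n^b` this is, for every FIXED size exponent `b`,
a nonzero equation for (the evaluation vectors of) `SmallCircuits F n b` computable by
constant-free projection circuits of size `n^{O(b)}` — a "`VPSPACE⁰`-natural proof against
`VP_n(n^b)`", the printed evidence on how definable equations for `VP` can be, to condition a
rung below `stmt-ValiantsHypothesis-8749` `SingleSizeEquations` (Boolean sums of size `poly(N)`,
`N = binom(2n,n)`; by `exists_coeffEquation_of_evalEquation` evaluation-vector equations transfer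
to coefficient-vector equations at cost `poly(N)` in ORDINARY circuit size) and
`stmt-ValiantsHypothesis-8745` `DefinableEquations`; Remark 1.5 of the source: "A `VP(N)` upper
bound on the equations of `VP(n)` would rule out a barrier … The bound we show is incomparable to
`VNP(N)`" (v1 wording: "incomparable to poly(N)").
[cite: ChatterjeeTengse2023, Lemma 4.7 (v1: Lemma 50)] locator: paper:arxiv-2309.07612 p0017.txt:L58–L60 -/
def CT23_lemma_4_7 : Prop :=
  ∀ (F : Type) [Field F] [CharZero F], ∃ c N₀ : ℕ, ∀ n d s : ℕ, N₀ ≤ n → N₀ ≤ d → N₀ ≤ s →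
    (n * d * s) ^ c ≤ (n + d).choose d →
    ∃ (t : ℕ) (P : MvPolynomial (monomialsDegLE n d) ℤ)
      (Q : ProjCircuit ℤ (monomialsDegLE n d ⊕ Fin t)),
      P ≠ 0 ∧ (∀ v, P.degreeOf v ≤ 1) ∧ Q.IsFanInTwo ∧ Q.HasSignConstants ∧
        Q.Computes (rename Sum.inl P) ∧ t ≤ (n * d * s) ^ c ∧ Q.size ≤ (n * d * s) ^ c ∧
          ∀ f : MvPolynomial (Fin n) F, f.totalDegree ≤ d → complexity f ≤ s →
            eval (evalVector F d f) (MvPolynomial.map (Int.castRingHom F) P) = 0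

/-! #### Erratum (kernel): Lemma 4.7 with its printed quantifiers is false -/

/-- Every polynomial of total degree `≤ d` in `n` variables has circuit complexity at most
`#x^{≤ d} · (2d + 2)` (sum of its monomials; the tree's `complexity_le_card_support_mul`).
[cite: ChatterjeeTengse2023, proof of Prop. 4.6 "algebraic circuits of size poly(N)" (v1: Prop. 49)] -/
theorem complexity_le_card_monomialsDegLE_mul {F : Type u} [Field F] {n d : ℕ}
    [Fintype (monomialsDegLE n d)] {f : MvPolynomial (Fin n) F} (hf : f.totalDegree ≤ d) :
    complexity f ≤ Fintype.card (monomialsDegLE n d) * (2 * d + 2) := by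
  classical
  refine (complexity_le_card_support_mul f).trans (Nat.mul_le_mul ?_ (by omega))
  have hsub : f.support ⊆
      (Finset.univ : Finset (monomialsDegLE n d)).map (Function.Embedding.subtype _) := by
    intro m' hm'
    have : m' ∈ monomialsDegLE n d := by
      change m'.degree ≤ d
      rw [Finsupp.degree_apply]
      exact (le_totalDegree hm').trans hf
    exact Finset.mem_map.mpr ⟨⟨m', this⟩, Finset.mem_univ _, rfl⟩
  simpa using Finset.card_le_card hsub

/-- The evaluation map `f ↦ evalVector F d f` is ONTO `F^{I_{n,d}}` on polynomials of degree `≤ d`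
(Prop. 4.4: the Vandermonde matrix of `I_{n,d}` is invertible; take the polynomial with
coefficient vector `V⁻¹ v`). [cite: ChatterjeeTengse2023, Prop. 4.4 (v1: Prop. 47)] -/
theorem exists_evalVector_eq {F : Type u} [Field F] [CharZero F] {n d : ℕ}
    [Fintype (monomialsDegLE n d)] (v : monomialsDegLE n d → F) :
    ∃ f : MvPolynomial (Fin n) F, f.totalDegree ≤ d ∧ evalVector F d f = v := by
  classical
  set c : monomialsDegLE n d → F := (simplexVandermonde F n d)⁻¹.mulVec v with hc
  set f : MvPolynomial (Fin n) F := ∑ μ : monomialsDegLE n d, monomial (μ : Fin n →₀ ℕ) (c μ)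
    with hfdef
  have hcoeff : ∀ μ : monomialsDegLE n d, coeff (μ : Fin n →₀ ℕ) f = c μ := fun μ => by
    rw [hfdef, coeff_sum, Finset.sum_eq_single μ]
    · simp
    · intro μ' _ hne
      rw [coeff_monomial, if_neg]
      exact fun h => hne (Subtype.ext h)
    · simp
  have hsupp : ∀ m ∈ f.support, m ∈ monomialsDegLE n d := fun m hm => by
    rw [hfdef] at hm
    obtain ⟨μ, -, hμ⟩ := Finset.mem_biUnion.1 (Finset.mem_of_subset support_sum hm)
    rw [support_monomial] at hμ
    split_ifs at hμ
    · simp at hμ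
    · rw [Finset.mem_singleton] at hμ
      exact hμ ▸ μ.2
  have hf : f.totalDegree ≤ d := by
    rw [totalDegree]
    refine Finset.sup_le fun m hm => ?_
    have := hsupp m hm
    change m.degree ≤ d at this
    rwa [Finsupp.degree] at this
  have hcv : coeffVector (monomialsDegLE n d) f = c := funext fun μ => by
    rw [coeffVector_apply, hcoeff]
  refine ⟨f, hf, ?_⟩
  rw [evalVector_eq_mulVec F hf, hcv, hc, Matrix.mulVec_mulVec,
    Matrix.mul_nonsing_inv _ (isUnit_det_simplexVandermonde F n d), Matrix.one_mulVec]

/-- An integer polynomial in the evaluation coordinates that vanishes (read in a field `F` of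
characteristic `0`) at the evaluation vector of EVERY polynomial of degree `≤ d` is zero: the
evaluation map is onto (Prop. 4.4) and `F` is infinite.
[cite: ChatterjeeTengse2023, Prop. 4.4 (v1: Prop. 47)] -/
theorem eq_zero_of_forall_eval_evalVector_eq_zero {F : Type u} [Field F] [CharZero F] {n d : ℕ}
    [Fintype (monomialsDegLE n d)] (P : MvPolynomial (monomialsDegLE n d) ℤ)
    (h : ∀ f : MvPolynomial (Fin n) F, f.totalDegree ≤ d →
      eval (evalVector F d f) (MvPolynomial.map (Int.castRingHom F) P) = 0) :
    P = 0 := by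
  haveI : Infinite F := Infinite.of_injective _ (Nat.cast_injective (R := F))
  have hP : MvPolynomial.map (Int.castRingHom F) P = 0 := by
    refine MvPolynomial.funext fun v => ?_
    obtain ⟨f, hf, hfv⟩ := exists_evalVector_eq (F := F) v
    rw [← hfv, h f hf, map_zero]
  exact map_injective (Int.castRingHom F) (Int.cast_injective (α := F)) (by simpa using hP)

/-- **CT23 Lemma 4.7 AS PRINTED** (typed for the record; REFUTED below, `not_CT23_lemma_4_7_asPrinted`;
the repaired statement is `CT23_lemma_4_7` above). "There exists a constant `c`, such that for all
large enough `n, d, s ∈ ℕ`, a multilinear equation for the evaluation vectors of the set of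
`n`-variate, degree-`d` polynomials computable by circuits of size `s`, is computable by
constant-free circuits with projection gates of size at most `(nds)^c`" — read literally, with NO
relation between `s` and `N = binom(n+d, d)` (bound workspace `⊕ Fin t` granted, the strongest
as-printed reading). Under-quantification found by val-lit lit g9 (registry A40/B40) and
independently in this seat. DO NOT USE as a hypothesis: it is false.
[cite: ChatterjeeTengse2023, Lemma 4.7 (v1: Lemma 50), as printed] locator: paper:arxiv-2309.07612 p0017.txt:L58–L60 -/
def CT23_lemma_4_7_asPrinted : Prop :=
  ∀ (F : Type) [Field F] [CharZero F], ∃ c N₀ : ℕ, ∀ n d s : ℕ, N₀ ≤ n → N₀ ≤ d → N₀ ≤ s →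
    ∃ (t : ℕ) (P : MvPolynomial (monomialsDegLE n d) ℤ)
      (Q : ProjCircuit ℤ (monomialsDegLE n d ⊕ Fin t)),
      P ≠ 0 ∧ (∀ v, P.degreeOf v ≤ 1) ∧ Q.IsFanInTwo ∧ Q.HasSignConstants ∧
        Q.Computes (rename Sum.inl P) ∧ t ≤ (n * d * s) ^ c ∧ Q.size ≤ (n * d * s) ^ c ∧
          ∀ f : MvPolynomial (Fin n) F, f.totalDegree ≤ d → complexity f ≤ s →
            eval (evalVector F d f) (MvPolynomial.map (Int.castRingHom F) P) = 0

/-- **ERRATUM (kernel refutation of Lemma 4.7 as printed).** Read literally — "for all large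
enough `n, d, s ∈ ℕ`" with NO relation between `s` and `N = binom(n+d, d)` — a nonzero equation for
the evaluation vectors of `{f : deg f ≤ d, complexity f ≤ s}` cannot exist (whatever circuit is to
compute it): at `n = d =` the threshold and `s ≥ #x^{≤ d}·(2d+2)` every degree-`≤ d` polynomial
has complexity `≤ s` (`complexity_le_card_monomialsDegLE_mul`), and a polynomial vanishing on ALL
evaluation vectors is zero (`eq_zero_of_forall_eval_evalVector_eq_zero`). Instantiated at
`F = ℚ`. Finding and recipe: val-lit lit g9 (registry B40, kernel text of 2026-08-27), written
independently here. The source's proof uses — and `CT23_lemma_4_7` above carries — the regime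
`(nds)^c ≤ binom(n+d, d)`.
[cite: ChatterjeeTengse2023, Lemma 4.7 (v1: Lemma 50), erratum] locator: paper:arxiv-2309.07612 p0017.txt:L58–L60 -/
theorem not_CT23_lemma_4_7_asPrinted : ¬ CT23_lemma_4_7_asPrinted := by
  intro h
  obtain ⟨c, N₀, hN⟩ := h ℚ
  letI : Fintype (monomialsDegLE N₀ N₀) := degLEMonomials.instFintype N₀
  set B : ℕ := Fintype.card (monomialsDegLE N₀ N₀) * (2 * N₀ + 2) with hB
  obtain ⟨t, P, Q, hP0, -, -, -, -, -, -, hvan⟩ :=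
    hN N₀ N₀ (max N₀ B) le_rfl le_rfl (le_max_left _ _)
  refine hP0 (eq_zero_of_forall_eval_evalVector_eq_zero (F := ℚ) P fun f hf => hvan f hf ?_)
  exact (complexity_le_card_monomialsDegLE_mul hf).trans (le_max_right _ _)

end Facts


/-! ### Appendix (API): Def. 2.19 / Def. 2.23 as circuit surgery — one projection gate, and the
source's simulation of summation / production gates ("these gates can be simulated using
projection gates and the usual sum, product gates"); attainment of `projComplexity` /
`constantFreeProjComplexity`; the cost bounds `+1` / `+3`; `VP⁰ ⊆ VPSPACE⁰` and closure of
`VPSPACE⁰` under projections, summations and productions. -/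

namespace ProjCircuit

section GateSurgery

variable {k : Type u} [CommSemiring k] {σ : Type v} [DecidableEq σ]

/-- One more gate appends one more value. [cite: ChatterjeeTengse2023, Def. 2.20 (v1: Def. 28)] -/
theorem gateValues_append_singleton (gs : List (Gate k σ)) (g : Gate k σ) :
    gateValues (gs ++ [g]) = gateValues gs ++ [g.eval (gateValues gs)] := by
  simp [gateValues, List.foldl_append]

/-- The value list has one entry per gate. [cite: ChatterjeeTengse2023, Def. 2.20 (v1: Def. 28)] -/
@[simp] theorem gateValues_length (gs : List (Gate k σ)) :
    (gateValues gs).length = gs.length := by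
  induction gs using List.reverseRecOn with
  | nil => rfl
  | append_singleton gs g ih => rw [gateValues_append_singleton]; simp [ih]

/-- **Def. 2.19 as surgery**: one projection gate `proj_{x_i = b} u` on top of a circuit with
output `u`. [cite: ChatterjeeTengse2023, Def. 2.19 (v1: Def. 27)] -/
def projectionCircuit (P : ProjCircuit k σ) (i : σ) (b : Bool) : ProjCircuit k σ where
  gates := P.gates ++ [Gate.proj i b (P.output.truncate P.gates.length)]
  output := .gate P.gates.length

/-- **Def. 2.23's simulation of a summation gate**: three more gates `proj_{x_i=0} u`,
`proj_{x_i=1} u`, and their sum, on top of a circuit with output `u`.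
[cite: ChatterjeeTengse2023, Def. 2.23 (v1: Def. 30)] -/
def summationCircuit (P : ProjCircuit k σ) (i : σ) : ProjCircuit k σ where
  gates := P.gates ++ [Gate.proj i false (P.output.truncate P.gates.length),
    Gate.proj i true (P.output.truncate P.gates.length),
    Gate.arith (.sum [(1, .gate P.gates.length), (1, .gate (P.gates.length + 1))])]
  output := .gate (P.gates.length + 2)

/-- **Def. 2.23's simulation of a production gate** (product of the two projections).
[cite: ChatterjeeTengse2023, Def. 2.23 (v1: Def. 30)] -/
def productionCircuit (P : ProjCircuit k σ) (i : σ) : ProjCircuit k σ where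
  gates := P.gates ++ [Gate.proj i false (P.output.truncate P.gates.length),
    Gate.proj i true (P.output.truncate P.gates.length),
    Gate.arith (.prod [.gate P.gates.length, .gate (P.gates.length + 1)])]
  output := .gate (P.gates.length + 2)

/-- Three more gates append three more values (unrolled `gateValues_append_singleton`). [folklore] -/
private theorem gateValues_append_three (gs : List (Gate k σ)) (g₁ g₂ g₃ : Gate k σ) :
    gateValues (gs ++ [g₁, g₂, g₃]) =
      gateValues gs ++ [g₁.eval (gateValues gs), g₂.eval (gateValues gs ++ [g₁.eval (gateValues gs)]),
        g₃.eval (gateValues gs ++ [g₁.eval (gateValues gs),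
          g₂.eval (gateValues gs ++ [g₁.eval (gateValues gs)])])] := by
  have h : gs ++ [g₁, g₂, g₃] = ((gs ++ [g₁]) ++ [g₂]) ++ [g₃] := by simp
  rw [h, gateValues_append_singleton, gateValues_append_singleton, gateValues_append_singleton]
  simp

/-- The truncated copy of the output operand ignores values appended after the original gates
(`ArithCircuit.Operand.eval_truncate_append` at `gateValues_length`). [folklore] -/
private theorem eval_truncate_gates (P : ProjCircuit k σ) (ws : List (MvPolynomial σ k)) :
    (P.output.truncate P.gates.length).eval (gateValues P.gates ++ ws) =
      P.output.eval (gateValues P.gates) := by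
  rw [← gateValues_length (k := k) P.gates]
  exact ArithCircuit.Operand.eval_truncate_append _ ws _

/-- The truncated copy of the output operand has the same value on the original gate values
(`ArithCircuit.Operand.eval_truncate`). [folklore] -/
private theorem eval_truncate_gates_nil (P : ProjCircuit k σ) :
    (P.output.truncate P.gates.length).eval (gateValues P.gates) =
      P.output.eval (gateValues P.gates) := by
  rw [← gateValues_length (k := k) P.gates]
  exact ArithCircuit.Operand.eval_truncate _ _

/-- The projection circuit computes `proj_{x_i = b} (P.eval)`.
[cite: ChatterjeeTengse2023, Def. 2.19 (v1: Def. 27)] -/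
theorem eval_projectionCircuit (P : ProjCircuit k σ) (i : σ) (b : Bool) :
    (P.projectionCircuit i b).eval = projVar i (if b then 1 else 0) P.eval := by
  have hlen := gateValues_length (k := k) P.gates
  simp [eval, projectionCircuit, gateValues_append_singleton, Gate.eval, eval_truncate_gates_nil,
    List.getD_eq_getElem?_getD, hlen]

/-- The summation circuit computes `Σ_{x_i} (P.eval)`. [cite: ChatterjeeTengse2023, Def. 2.23 (v1: Def. 30)] -/
theorem eval_summationCircuit (P : ProjCircuit k σ) (i : σ) :
    (P.summationCircuit i).eval = summation i P.eval := by
  have hlen := gateValues_length (k := k) P.gates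
  simp [eval, summationCircuit, gateValues_append_three, Gate.eval, ArithCircuit.Gate.eval,
    eval_truncate_gates, eval_truncate_gates_nil, List.getD_eq_getElem?_getD, hlen, summation]

/-- The production circuit computes `Π_{x_i} (P.eval)`. [cite: ChatterjeeTengse2023, Def. 2.23 (v1: Def. 30)] -/
theorem eval_productionCircuit (P : ProjCircuit k σ) (i : σ) :
    (P.productionCircuit i).eval = production i P.eval := by
  have hlen := gateValues_length (k := k) P.gates
  simp [eval, productionCircuit, gateValues_append_three, Gate.eval, ArithCircuit.Gate.eval,
    eval_truncate_gates, eval_truncate_gates_nil, List.getD_eq_getElem?_getD, hlen, production]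

omit [DecidableEq σ] in
/-- Size bookkeeping: one extra gate. [cite: ChatterjeeTengse2023, Def. 2.19 (v1: Def. 27)] -/
@[simp] theorem size_projectionCircuit (P : ProjCircuit k σ) (i : σ) (b : Bool) :
    (P.projectionCircuit i b).size = P.size + 1 := by
  simp [size, projectionCircuit]

omit [DecidableEq σ] in
/-- Size bookkeeping: three extra gates. [cite: ChatterjeeTengse2023, Def. 2.23 (v1: Def. 30)] -/
@[simp] theorem size_summationCircuit (P : ProjCircuit k σ) (i : σ) :
    (P.summationCircuit i).size = P.size + 3 := by
  simp [size, summationCircuit]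

omit [DecidableEq σ] in
/-- Size bookkeeping: three extra gates. [cite: ChatterjeeTengse2023, Def. 2.23 (v1: Def. 30)] -/
@[simp] theorem size_productionCircuit (P : ProjCircuit k σ) (i : σ) :
    (P.productionCircuit i).size = P.size + 3 := by
  simp [size, productionCircuit]

omit [DecidableEq σ] in
/-- Fan-in two is kept (a projection gate has one operand). [cite: ChatterjeeTengse2023, Def. 2.19 (v1: Def. 27)] -/
theorem isFanInTwo_projectionCircuit {P : ProjCircuit k σ} (h : P.IsFanInTwo) (i : σ) (b : Bool) :
    (P.projectionCircuit i b).IsFanInTwo := by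
  intro g hg
  simp only [projectionCircuit, List.mem_append, List.mem_cons, List.mem_nil_iff, or_false] at hg
  rcases hg with hg | rfl
  · exact h g hg
  · simp [Gate.fanIn]

omit [DecidableEq σ] in
/-- Fan-in two is kept. [cite: ChatterjeeTengse2023, Def. 2.23 (v1: Def. 30)] -/
theorem isFanInTwo_summationCircuit {P : ProjCircuit k σ} (h : P.IsFanInTwo) (i : σ) :
    (P.summationCircuit i).IsFanInTwo := by
  intro g hg
  simp only [summationCircuit, List.mem_append, List.mem_cons, List.mem_nil_iff, or_false] at hg
  rcases hg with hg | rfl | rfl | rfl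
  · exact h g hg
  all_goals simp [Gate.fanIn, ArithCircuit.Gate.fanIn, ArithCircuit.Gate.args]

omit [DecidableEq σ] in
/-- Fan-in two is kept. [cite: ChatterjeeTengse2023, Def. 2.23 (v1: Def. 30)] -/
theorem isFanInTwo_productionCircuit {P : ProjCircuit k σ} (h : P.IsFanInTwo) (i : σ) :
    (P.productionCircuit i).IsFanInTwo := by
  intro g hg
  simp only [productionCircuit, List.mem_append, List.mem_cons, List.mem_nil_iff, or_false] at hg
  rcases hg with hg | rfl | rfl | rfl
  · exact h g hg
  all_goals simp [Gate.fanIn, ArithCircuit.Gate.fanIn, ArithCircuit.Gate.args]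

omit [DecidableEq σ] in
/-- Constant-freeness is kept. [cite: ChatterjeeTengse2023, Def. 2.19–2.20 (v1: Def. 27–28)] -/
theorem hasSignConstants_projectionCircuit {P : ProjCircuit k σ} (h : P.HasSignConstants) (i : σ)
    (b : Bool) : (P.projectionCircuit i b).HasSignConstants := by
  refine ⟨fun g hg => ?_, trivial⟩
  simp only [projectionCircuit, List.mem_append, List.mem_cons, List.mem_nil_iff, or_false] at hg
  rcases hg with hg | rfl
  · exact h.1 g hg
  · exact h.2.truncate _

omit [DecidableEq σ] in
/-- Constant-freeness is kept (the new coefficients are `1`). [cite: ChatterjeeTengse2023, Def. 2.23 (v1: Def. 30)] -/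
theorem hasSignConstants_summationCircuit {P : ProjCircuit k σ} (h : P.HasSignConstants) (i : σ) :
    (P.summationCircuit i).HasSignConstants := by
  refine ⟨fun g hg => ?_, trivial⟩
  simp only [summationCircuit, List.mem_append, List.mem_cons, List.mem_nil_iff, or_false] at hg
  rcases hg with hg | rfl | rfl | rfl
  · exact h.1 g hg
  · exact h.2.truncate _
  · exact h.2.truncate _
  · intro a ha
    simp only [List.mem_cons, List.mem_nil_iff, or_false] at ha
    rcases ha with rfl | rfl <;> exact ⟨Or.inr (Or.inl rfl), trivial⟩

omit [DecidableEq σ] in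
/-- Constant-freeness is kept. [cite: ChatterjeeTengse2023, Def. 2.23 (v1: Def. 30)] -/
theorem hasSignConstants_productionCircuit {P : ProjCircuit k σ} (h : P.HasSignConstants) (i : σ) :
    (P.productionCircuit i).HasSignConstants := by
  refine ⟨fun g hg => ?_, trivial⟩
  simp only [productionCircuit, List.mem_append, List.mem_cons, List.mem_nil_iff, or_false] at hg
  rcases hg with hg | rfl | rfl | rfl
  · exact h.1 g hg
  · exact h.2.truncate _
  · exact h.2.truncate _
  · intro u hu
    simp only [List.mem_cons, List.mem_nil_iff, or_false] at hu
    rcases hu with rfl | rfl <;> trivial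

end GateSurgery

end ProjCircuit

section ComplexityAPI

variable {k : Type u} [CommSemiring k] {σ : Type v} [DecidableEq σ]

/-- `projComplexity f` is attained (no `sInf ∅` junk): some fan-in-two projection circuit of that
size computes `f`. [cite: ChatterjeeTengse2023, Def. 2.20 (v1: Def. 28)] -/
theorem exists_computes_size_eq_projComplexity (f : MvPolynomial σ k) :
    ∃ P : ProjCircuit k σ, P.IsFanInTwo ∧ P.Computes f ∧ P.size = projComplexity f := by
  obtain ⟨Q, h2, hf, -⟩ := ArithCircuit.exists_computes_size_eq_complexity f
  exact Nat.sInf_mem (⟨(ProjCircuit.ofArithCircuit Q).size, ProjCircuit.ofArithCircuit Q,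
    ProjCircuit.isFanInTwo_ofArithCircuit h2,
    by simpa [ProjCircuit.Computes, ArithCircuit.Computes] using hf, rfl⟩ :
      Set.Nonempty {s | ∃ P : ProjCircuit k σ, P.IsFanInTwo ∧ P.Computes f ∧ P.size = s})

/-- A projection gate costs one gate: `L^proj(proj_{x_i=b} f) ≤ L^proj(f) + 1`.
[cite: ChatterjeeTengse2023, Def. 2.19–2.20 (v1: Def. 27–28)] -/
theorem projComplexity_projVar_le (i : σ) (b : Bool) (f : MvPolynomial σ k) :
    projComplexity (projVar i (if b then 1 else 0) f) ≤ projComplexity f + 1 := by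
  obtain ⟨P, h2, hf, hs⟩ := exists_computes_size_eq_projComplexity f
  rw [← hs, ← ProjCircuit.size_projectionCircuit P i b]
  refine projComplexity_le_size (ProjCircuit.isFanInTwo_projectionCircuit h2 i b) ?_
  rw [ProjCircuit.Computes, ProjCircuit.eval_projectionCircuit, hf]

/-- Summation gates cost at most three (fan-in-two) gates: `L^proj(Σ_{x_i} f) ≤ L^proj(f) + 3`.
[cite: ChatterjeeTengse2023, Def. 2.23 (v1: Def. 30)] -/
theorem projComplexity_summation_le (i : σ) (f : MvPolynomial σ k) :
    projComplexity (summation i f) ≤ projComplexity f + 3 := by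
  obtain ⟨P, h2, hf, hs⟩ := exists_computes_size_eq_projComplexity f
  rw [← hs, ← ProjCircuit.size_summationCircuit P i]
  refine projComplexity_le_size (ProjCircuit.isFanInTwo_summationCircuit h2 i) ?_
  rw [ProjCircuit.Computes, ProjCircuit.eval_summationCircuit, hf]

/-- Production gates cost at most three gates: `L^proj(Π_{x_i} f) ≤ L^proj(f) + 3`.
[cite: ChatterjeeTengse2023, Def. 2.23 (v1: Def. 30)] -/
theorem projComplexity_production_le (i : σ) (f : MvPolynomial σ k) :
    projComplexity (production i f) ≤ projComplexity f + 3 := by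
  obtain ⟨P, h2, hf, hs⟩ := exists_computes_size_eq_projComplexity f
  rw [← hs, ← ProjCircuit.size_productionCircuit P i]
  refine projComplexity_le_size (ProjCircuit.isFanInTwo_productionCircuit h2 i) ?_
  rw [ProjCircuit.Computes, ProjCircuit.eval_productionCircuit, hf]

/-- Over `ℤ`, `constantFreeProjComplexity f` is attained: some constant-free fan-in-two
projection circuit of that size computes `f` (via the tree's
`ArithCircuit.exists_computes_size_eq_constantFreeComplexity`).
[cite: ChatterjeeTengse2023, Def. 2.20 (v1: Def. 28)] -/
theorem exists_computes_size_eq_constantFreeProjComplexity (f : MvPolynomial σ ℤ) :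
    ∃ P : ProjCircuit ℤ σ, P.IsFanInTwo ∧ P.HasSignConstants ∧ P.Computes f ∧
      P.size = constantFreeProjComplexity f := by
  obtain ⟨Q, h2, hc, hf, -⟩ := ArithCircuit.exists_computes_size_eq_constantFreeComplexity f
  exact Nat.sInf_mem (⟨(ProjCircuit.ofArithCircuit Q).size, ProjCircuit.ofArithCircuit Q,
    ProjCircuit.isFanInTwo_ofArithCircuit h2, ProjCircuit.hasSignConstants_ofArithCircuit hc,
    by simpa [ProjCircuit.Computes, ArithCircuit.Computes] using hf, rfl⟩ :
      Set.Nonempty {s | ∃ P : ProjCircuit ℤ σ,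
        P.IsFanInTwo ∧ P.HasSignConstants ∧ P.Computes f ∧ P.size = s})

/-- **Projection gates only help, constant-free version over `ℤ`**:
`constantFreeProjComplexity f ≤ constantFreeComplexity f` (the name announced in the docstring
of `constantFreeProjComplexity`). [cite: ChatterjeeTengse2023, §2.2 "Comparison with VP" (v1: p0011.txt:L20)] -/
theorem constantFreeProjComplexity_le_constantFreeComplexity (f : MvPolynomial σ ℤ) :
    constantFreeProjComplexity f ≤ constantFreeComplexity f := by
  obtain ⟨Q, h2, hc, hf, hs⟩ := ArithCircuit.exists_computes_size_eq_constantFreeComplexity f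
  rw [← hs]
  exact constantFreeProjComplexity_le_of_arithCircuit h2 hc hf

/-- Constant-free cost of a projection gate over `ℤ`: `+1`.
[cite: ChatterjeeTengse2023, Def. 2.19–2.20 (v1: Def. 27–28)] -/
theorem constantFreeProjComplexity_projVar_le (i : σ) (b : Bool) (f : MvPolynomial σ ℤ) :
    constantFreeProjComplexity (projVar i (if b then 1 else 0) f) ≤
      constantFreeProjComplexity f + 1 := by
  obtain ⟨P, h2, hc, hf, hs⟩ := exists_computes_size_eq_constantFreeProjComplexity f
  rw [← hs, ← ProjCircuit.size_projectionCircuit P i b]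
  refine constantFreeProjComplexity_le_size (ProjCircuit.isFanInTwo_projectionCircuit h2 i b)
    (ProjCircuit.hasSignConstants_projectionCircuit hc i b) ?_
  rw [ProjCircuit.Computes, ProjCircuit.eval_projectionCircuit, hf]

/-- Constant-free cost of a summation gate over `ℤ`: `+3`. [cite: ChatterjeeTengse2023, Def. 2.23 (v1: Def. 30)] -/
theorem constantFreeProjComplexity_summation_le (i : σ) (f : MvPolynomial σ ℤ) :
    constantFreeProjComplexity (summation i f) ≤ constantFreeProjComplexity f + 3 := by
  obtain ⟨P, h2, hc, hf, hs⟩ := exists_computes_size_eq_constantFreeProjComplexity f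
  rw [← hs, ← ProjCircuit.size_summationCircuit P i]
  refine constantFreeProjComplexity_le_size (ProjCircuit.isFanInTwo_summationCircuit h2 i)
    (ProjCircuit.hasSignConstants_summationCircuit hc i) ?_
  rw [ProjCircuit.Computes, ProjCircuit.eval_summationCircuit, hf]

/-- Constant-free cost of a production gate over `ℤ`: `+3`. [cite: ChatterjeeTengse2023, Def. 2.23 (v1: Def. 30)] -/
theorem constantFreeProjComplexity_production_le (i : σ) (f : MvPolynomial σ ℤ) :
    constantFreeProjComplexity (production i f) ≤ constantFreeProjComplexity f + 3 := by
  obtain ⟨P, h2, hc, hf, hs⟩ := exists_computes_size_eq_constantFreeProjComplexity f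
  rw [← hs, ← ProjCircuit.size_productionCircuit P i]
  refine constantFreeProjComplexity_le_size (ProjCircuit.isFanInTwo_productionCircuit h2 i)
    (ProjCircuit.hasSignConstants_productionCircuit hc i) ?_
  rw [ProjCircuit.Computes, ProjCircuit.eval_productionCircuit, hf]

end ComplexityAPI

section VPSPACE0Closure

variable {σ : ℕ → Type v} [∀ N, Fintype (σ N)] [∀ N, DecidableEq (σ N)]

/-- **`VP⁰ ⊆ VPSPACE⁰`** (§2.2 "Comparison with VP": projection gates only add power): a family
computed by p-bounded constant-free circuits is computed by the same circuits read as projection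
circuits (no workspace, `t = 0`). [cite: ChatterjeeTengse2023, §2.2 before Prop. 2.24 (v1: p0011.txt:L20–L28)] -/
theorem isVPSPACE0Family_of_isVP0Family {P : ∀ N, MvPolynomial (σ N) ℤ} (h : IsVP0Family P) :
    IsVPSPACE0Family P := by
  obtain ⟨hcard, C, hC, hsize, -⟩ := h
  refine ⟨hcard, fun _ => 0, fun N => ProjCircuit.ofArithCircuit ((C N).rename Sum.inl),
    IsPBounded.const 0, fun N => ⟨?_, ?_, ?_⟩, ?_⟩
  · exact ProjCircuit.isFanInTwo_ofArithCircuit ((hC N).1.rename _)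
  · exact ProjCircuit.hasSignConstants_ofArithCircuit ((hC N).2.1.rename _)
  · simpa [ProjCircuit.Computes, ArithCircuit.Computes] using (hC N).2.2.rename Sum.inl
  · simpa [ArithCircuit.size_rename] using hsize

/-- `VPSPACE⁰` is closed under one projection of a free variable per level (Def. 2.19–2.20:
projection gates are gates). [cite: ChatterjeeTengse2023, Def. 2.19–2.20 (v1: Def. 27–28)] -/
theorem IsVPSPACE0Family.projVar {P : ∀ N, MvPolynomial (σ N) ℤ} (h : IsVPSPACE0Family P)
    (i : ∀ N, σ N) (b : ℕ → Bool) :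
    IsVPSPACE0Family fun N => projVar (i N) (if b N then 1 else 0) (P N) := by
  obtain ⟨hcard, t, C, ht, hC, hsize⟩ := h
  refine ⟨hcard, t, fun N => (C N).projectionCircuit (Sum.inl (i N)) (b N), ht,
    fun N => ⟨?_, ?_, ?_⟩, ?_⟩
  · exact ProjCircuit.isFanInTwo_projectionCircuit (hC N).1 _ _
  · exact ProjCircuit.hasSignConstants_projectionCircuit (hC N).2.1 _ _
  · rw [ProjCircuit.Computes, ProjCircuit.eval_projectionCircuit, (hC N).2.2,
      projVar_rename Sum.inl_injective]
  · simpa using IsPBounded.add_holds hsize (IsPBounded.const 1)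

/-- `VPSPACE⁰` is closed under one summation gate over a free variable per level (Def. 2.23:
"these gates can be simulated using projection gates and the usual sum, product gates", `+3`
gates each). [cite: ChatterjeeTengse2023, Def. 2.23 (v1: Def. 30)] -/
theorem IsVPSPACE0Family.summation {P : ∀ N, MvPolynomial (σ N) ℤ} (h : IsVPSPACE0Family P)
    (i : ∀ N, σ N) : IsVPSPACE0Family fun N => summation (i N) (P N) := by
  obtain ⟨hcard, t, C, ht, hC, hsize⟩ := h
  refine ⟨hcard, t, fun N => (C N).summationCircuit (Sum.inl (i N)), ht,
    fun N => ⟨?_, ?_, ?_⟩, ?_⟩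
  · exact ProjCircuit.isFanInTwo_summationCircuit (hC N).1 _
  · exact ProjCircuit.hasSignConstants_summationCircuit (hC N).2.1 _
  · rw [ProjCircuit.Computes, ProjCircuit.eval_summationCircuit, (hC N).2.2,
      summation_rename Sum.inl_injective]
  · simpa using IsPBounded.add_holds hsize (IsPBounded.const 3)

/-- `VPSPACE⁰` is closed under one production gate over a free variable per level.
[cite: ChatterjeeTengse2023, Def. 2.23 (v1: Def. 30)] -/
theorem IsVPSPACE0Family.production {P : ∀ N, MvPolynomial (σ N) ℤ} (h : IsVPSPACE0Family P)
    (i : ∀ N, σ N) : IsVPSPACE0Family fun N => production (i N) (P N) := by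
  obtain ⟨hcard, t, C, ht, hC, hsize⟩ := h
  refine ⟨hcard, t, fun N => (C N).productionCircuit (Sum.inl (i N)), ht,
    fun N => ⟨?_, ?_, ?_⟩, ?_⟩
  · exact ProjCircuit.isFanInTwo_productionCircuit (hC N).1 _
  · exact ProjCircuit.hasSignConstants_productionCircuit (hC N).2.1 _
  · rw [ProjCircuit.Computes, ProjCircuit.eval_productionCircuit, (hC N).2.2,
      production_rename Sum.inl_injective]
  · simpa using IsPBounded.add_holds hsize (IsPBounded.const 3)

end VPSPACE0Closure

/-! ### `VNP⁰ ⊆ VPSPACE⁰`: Valiant's Boolean sum by summation gates over workspace bits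
(§2.2 "Comparison with VP"; the adequacy test for the workspace variables of `IsVPSPACE0Family`) -/

section BoolSumByProjections

variable {k : Type u} [CommSemiring k] {τ : Type v} [DecidableEq τ] {m : ℕ}

omit [DecidableEq τ] in
/-- `proj` fixes `1`. [cite: ChatterjeeTengse2023, Def. 2.19 (v1: Def. 27)] -/
@[simp] theorem projVar_one {σ : Type v} [DecidableEq σ] (i : σ) (b : k) :
    projVar i b (1 : MvPolynomial σ k) = 1 := by
  simp [projVar]

omit [DecidableEq τ] in
/-- `proj` fixes `0`. [cite: ChatterjeeTengse2023, Def. 2.19 (v1: Def. 27)] -/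
@[simp] theorem projVar_zero {σ : Type v} [DecidableEq σ] (i : σ) (b : k) :
    projVar i b (0 : MvPolynomial σ k) = 0 := by
  simp [projVar]

omit [DecidableEq τ] in
/-- `proj` through a substitution: `proj_{x_i=b} (g(t_1, …)) = g(proj_{x_i=b} t_1, …)`.
[cite: ChatterjeeTengse2023, Def. 2.19 (v1: Def. 27)] -/
theorem projVar_aeval {σ : Type v} [DecidableEq σ] {ι : Type w} (i : σ) (b : k)
    (t : ι → MvPolynomial σ k) (g : MvPolynomial ι k) :
    projVar i b (aeval t g) = aeval (fun v => projVar i b (t v)) g := by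
  unfold projVar
  rw [← AlgHom.comp_apply, comp_aeval]

/-- Substituting Boolean constants `e` for the first `j` workspace bits `inr 0, …, inr (j-1)` and
leaving every other variable alone. [cite: ChatterjeeTengse2023, Def. 2.23 (v1: Def. 30)] -/
def bitSubst (j : ℕ) (e : Fin j → Bool) : τ ⊕ Fin m → MvPolynomial (τ ⊕ Fin m) k :=
  Sum.elim (fun i => X (Sum.inl i)) fun i =>
    if h : (i : ℕ) < j then (if e ⟨i, h⟩ then 1 else 0) else X (Sum.inr i)

/-- The partial Boolean sum over the first `j` workspace bits:
`Σ_{e ∈ {0,1}^j} g(x, e, y_j, …, y_{m-1})`. [cite: ChatterjeeTengse2023, Def. 2.23 (v1: Def. 30)] -/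
def partialBoolSum (j : ℕ) (g : MvPolynomial (τ ⊕ Fin m) k) : MvPolynomial (τ ⊕ Fin m) k :=
  ∑ e : Fin j → Bool, aeval (bitSubst j e) g

omit [DecidableEq τ] in
/-- No bit summed: the polynomial itself. [cite: ChatterjeeTengse2023, Def. 2.23 (v1: Def. 30)] -/
theorem partialBoolSum_zero (g : MvPolynomial (τ ⊕ Fin m) k) : partialBoolSum 0 g = g := by
  rw [partialBoolSum, Fintype.sum_unique]
  have : ∀ e : Fin 0 → Bool, bitSubst (k := k) (τ := τ) (m := m) 0 e = X := fun e => by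
    funext v; cases v <;> simp [bitSubst]
  rw [this, aeval_X_left, AlgHom.id_apply]

/-- One projection of the next bit turns the substitution of `j` bits into that of `j + 1` bits.
[cite: ChatterjeeTengse2023, Def. 2.23 (v1: Def. 30)] -/
theorem projVar_bitSubst {j : ℕ} (hj : j < m) (e : Fin j → Bool) (b : Bool) (v : τ ⊕ Fin m) :
    projVar (Sum.inr ⟨j, hj⟩) (if b then 1 else 0) (bitSubst (k := k) j e v) =
      bitSubst (j + 1) (Fin.snoc e b) v := by
  rcases v with i | i
  · simp [bitSubst]
  · simp only [bitSubst, Sum.elim_inr]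
    rcases lt_trichotomy (i : ℕ) j with hlt | heq | hgt
    · have h1 : (i : ℕ) < j + 1 := by omega
      have hs : Fin.snoc (α := fun _ => Bool) e b ⟨i, h1⟩ = e ⟨i, hlt⟩ := by
        have : (⟨i, h1⟩ : Fin (j + 1)) = Fin.castSucc ⟨i, hlt⟩ := Fin.ext rfl
        rw [this, Fin.snoc_castSucc]
      rw [dif_pos hlt, dif_pos h1, hs]
      split_ifs <;> simp
    · have h1 : (i : ℕ) < j + 1 := by omega
      have hij : Sum.inr i = (Sum.inr ⟨j, hj⟩ : τ ⊕ Fin m) := by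
        rw [Sum.inr.injEq]; exact Fin.ext heq
      have hs : Fin.snoc (α := fun _ => Bool) e b ⟨i, h1⟩ = b := by
        have : (⟨i, h1⟩ : Fin (j + 1)) = Fin.last j := Fin.ext heq
        rw [this, Fin.snoc_last]
      rw [dif_neg (by omega), dif_pos h1, hs, hij, projVar_X_self]
      cases b <;> simp
    · have hne : (Sum.inr i : τ ⊕ Fin m) ≠ Sum.inr ⟨j, hj⟩ := by
        intro h; rw [Sum.inr.injEq] at h; exact absurd (congrArg Fin.val h) (by simp; omega)
      rw [dif_neg (by omega), dif_neg (by omega), projVar_X_of_ne hne]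

/-- **One summation gate per bit**: `Σ_{y_j} (Σ_{e ∈ {0,1}^j} g(x, e, y_j, …)) =
Σ_{e ∈ {0,1}^{j+1}} g(x, e, y_{j+1}, …)`. [cite: ChatterjeeTengse2023, Def. 2.23 (v1: Def. 30)] -/
theorem summation_partialBoolSum {j : ℕ} (hj : j < m) (g : MvPolynomial (τ ⊕ Fin m) k) :
    summation (Sum.inr ⟨j, hj⟩) (partialBoolSum j g) = partialBoolSum (j + 1) g := by
  have key : ∀ b : Bool, projVar (Sum.inr ⟨j, hj⟩) (if b then 1 else 0) (partialBoolSum j g) =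
      ∑ e : Fin j → Bool, aeval (bitSubst (j + 1) (Fin.snoc e b)) g := fun b => by
    rw [partialBoolSum, projVar, map_sum]
    refine Finset.sum_congr rfl fun e _ => ?_
    change projVar (Sum.inr ⟨j, hj⟩) (if b then 1 else 0) (aeval (bitSubst j e) g) = _
    rw [projVar_aeval]
    have hfun : (fun v => projVar (Sum.inr ⟨j, hj⟩) (if b then 1 else 0) (bitSubst j e v)) =
        bitSubst (k := k) (τ := τ) (m := m) (j + 1) (Fin.snoc e b) :=
      funext fun v => projVar_bitSubst hj e b v
    rw [hfun]
  have h0 := key false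
  have h1 := key true
  simp only [Bool.false_eq_true, ↓reduceIte] at h0
  simp only [↓reduceIte] at h1
  rw [summation, h0, h1, partialBoolSum,
    ← Fintype.sum_equiv (Fin.snocEquiv fun _ => Bool) (fun p => aeval (bitSubst (j + 1)
      (Fin.snoc p.2 p.1)) g) _ (fun p => rfl), Fintype.sum_prod_type, Fintype.sum_bool, add_comm]

omit [DecidableEq τ] in
/-- All `m` bits summed: Valiant's Boolean sum `Σ_{e ∈ {0,1}^m} g(x, e)` (the tree's `boolSum`),
read in the ring with the workspace bits. [cite: ChatterjeeTengse2023, §2.2 "Comparison with VP" (v1: p0011.txt:L20–L28)] -/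
theorem partialBoolSum_eq_rename_boolSum (g : MvPolynomial (τ ⊕ Fin m) k) :
    partialBoolSum m g = rename Sum.inl (boolSum g) := by
  rw [partialBoolSum, boolSum, map_sum]
  refine Finset.sum_congr rfl fun e _ => ?_
  rw [← AlgHom.comp_apply, comp_aeval]
  have hfun : (fun v => rename Sum.inl (Sum.elim X (fun j => if e j then (1 : MvPolynomial τ k) else 0) v)) =
      bitSubst (k := k) (τ := τ) (m := m) m e := by
    funext v
    rcases v with i | i
    · simp [bitSubst]
    · simp only [bitSubst, Sum.elim_inr, dif_pos i.is_lt, Fin.eta]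
      split_ifs <;> simp
  rw [hfun]

namespace ProjCircuit

/-- **The circuit**: `j` summation gates over the workspace bits `inr 0, …, inr (j-1)` on top of
`P` (Def. 2.23's simulation, `+3` gates each). [cite: ChatterjeeTengse2023, Def. 2.23 (v1: Def. 30)] -/
def boolSumCircuit (P : ProjCircuit k (τ ⊕ Fin m)) : ℕ → ProjCircuit k (τ ⊕ Fin m)
  | 0 => P
  | j + 1 => if h : j < m then (boolSumCircuit P j).summationCircuit (Sum.inr ⟨j, h⟩)
      else boolSumCircuit P j

/-- It computes the partial Boolean sums. [cite: ChatterjeeTengse2023, Def. 2.23 (v1: Def. 30)] -/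
theorem eval_boolSumCircuit (P : ProjCircuit k (τ ⊕ Fin m)) {j : ℕ} (hj : j ≤ m) :
    (P.boolSumCircuit j).eval = partialBoolSum j P.eval := by
  induction j with
  | zero => rw [boolSumCircuit, partialBoolSum_zero]
  | succ j ih =>
    have hj' : j < m := by omega
    rw [boolSumCircuit, dif_pos hj', eval_summationCircuit, ih hj'.le, summation_partialBoolSum]

omit [DecidableEq τ] in
/-- Size: `+3` per bit. [cite: ChatterjeeTengse2023, Def. 2.23 (v1: Def. 30)] -/
theorem size_boolSumCircuit (P : ProjCircuit k (τ ⊕ Fin m)) {j : ℕ} (hj : j ≤ m) :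
    (P.boolSumCircuit j).size = P.size + 3 * j := by
  induction j with
  | zero => rfl
  | succ j ih =>
    have hj' : j < m := by omega
    rw [boolSumCircuit, dif_pos hj', size_summationCircuit, ih hj'.le]
    ring

omit [DecidableEq τ] in
/-- Fan-in two is kept. [cite: ChatterjeeTengse2023, Def. 2.23 (v1: Def. 30)] -/
theorem isFanInTwo_boolSumCircuit {P : ProjCircuit k (τ ⊕ Fin m)} (h : P.IsFanInTwo) (j : ℕ) :
    (P.boolSumCircuit j).IsFanInTwo := by
  induction j with
  | zero => exact h
  | succ j ih =>
    rw [boolSumCircuit]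
    split_ifs
    · exact isFanInTwo_summationCircuit ih _
    · exact ih

omit [DecidableEq τ] in
/-- Constant-freeness is kept. [cite: ChatterjeeTengse2023, Def. 2.23 (v1: Def. 30)] -/
theorem hasSignConstants_boolSumCircuit {P : ProjCircuit k (τ ⊕ Fin m)} (h : P.HasSignConstants)
    (j : ℕ) : (P.boolSumCircuit j).HasSignConstants := by
  induction j with
  | zero => exact h
  | succ j ih =>
    rw [boolSumCircuit]
    split_ifs
    · exact hasSignConstants_summationCircuit ih _
    · exact ih

end ProjCircuit

end BoolSumByProjections

section VNP0

variable {σ : ℕ → Type v} [∀ N, Fintype (σ N)] [∀ N, DecidableEq (σ N)]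

/-- **`VNP⁰ ⊆ VPSPACE⁰`** ("`VPSPACE` corresponds to a class as powerful as `PSPACE`", §2.2; the
inclusion `VNP ⊆ VPSPACE` of [Poizat 2008], [KP09]): Valiant's Boolean sum
`f_N = Σ_{e ∈ {0,1}^{u(N)}} g_N(x, e)` of a `VP⁰` family is computed by the constant-free circuit of
`g_N` followed by one summation gate per bit `e_j` — the bits being exactly the bound WORKSPACE
variables of `IsVPSPACE0Family` (size `size(g_N) + 3u(N)`).
[cite: ChatterjeeTengse2023, §2.2 "Comparison with VP" and Def. 2.23 (v1: Def. 30, p0011.txt:L20–L28)] -/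
theorem isVPSPACE0Family_of_isVNP0Family {P : ∀ N, MvPolynomial (σ N) ℤ} (h : IsVNP0Family P) :
    IsVPSPACE0Family P := by
  obtain ⟨u, g, hu, hg, hP⟩ := h.exists_isPBounded
  obtain ⟨hcard, C, hC, hsize, -⟩ := hg
  refine ⟨hcard.mono fun N => by simp [Fintype.card_sum], u,
    fun N => (ProjCircuit.ofArithCircuit (C N)).boolSumCircuit (u N), hu, fun N => ⟨?_, ?_, ?_⟩, ?_⟩
  · exact ProjCircuit.isFanInTwo_boolSumCircuit (ProjCircuit.isFanInTwo_ofArithCircuit (hC N).1) _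
  · exact ProjCircuit.hasSignConstants_boolSumCircuit
      (ProjCircuit.hasSignConstants_ofArithCircuit (hC N).2.1) _
  · rw [ProjCircuit.Computes, ProjCircuit.eval_boolSumCircuit _ le_rfl, ProjCircuit.eval_ofArithCircuit,
      partialBoolSum_eq_rename_boolSum, show (C N).eval = g N from (hC N).2.2, ← hP N]
  · refine (IsPBounded.add_holds hsize (IsPBounded.mul_holds (IsPBounded.const 3) hu)).mono fun N => ?_
    rw [ProjCircuit.size_boolSumCircuit _ le_rfl, ProjCircuit.size_ofArithCircuit]

/-- **`PER ∈ VPSPACE⁰`**: the permanent family (the tree's `isVNP0Family_perPoly`, Ryser witness)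
is computed by p-bounded constant-free circuits with projection gates ("`VPSPACE` … is known to
be extremely powerful" and contains `VNP`, §1.1). [cite: ChatterjeeTengse2023, §1.1 and §2.2 "Comparison with VP" (v1: p0011.txt:L20–L28)] -/
theorem isVPSPACE0Family_perPoly :
    IsVPSPACE0Family (σ := fun n => Fin n × Fin n) fun n => perPoly (Fin n) ℤ :=
  isVPSPACE0Family_of_isVNP0Family isVNP0Family_perPoly

/-- **`HC ∈ VPSPACE⁰`**: the Hamiltonian-cycle family (the tree's `isVNP0Family_hcPoly`) is in
`VPSPACE⁰`. [cite: ChatterjeeTengse2023, §2.2 "Comparison with VP" (v1: p0011.txt:L20–L28)] -/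
theorem isVPSPACE0Family_hcPoly :
    IsVPSPACE0Family (σ := fun n => Fin n × Fin n) fun n => hcPoly (Fin n) ℤ :=
  isVPSPACE0Family_of_isVNP0Family isVNP0Family_hcPoly

end VNP0

end Literature.Barriers.ValiantsHypothesis
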